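import Summits.KontsevichZagierPeriods.KontsevichZagierPeriods.Theses.TerasomaMultiplication
import Summits.KontsevichZagierPeriods.KontsevichZagierPeriods.Theorems.GammaHodgeSector.Negative.LoadBearing
import Summits.KontsevichZagierPeriods.KontsevichZagierPeriods.Theorems.GammaHodgeSector.Negative.HodgeTest
import Literature.NumberTheory.Transcendental.KZKernelConjectureForms
import Literature.NumberTheory.Transcendental.KZSubcalculusInvariants
import Literature.NumberTheory.Transcendental.KZCalculusProofs
import Literature.Barriers.KontsevichZagierPeriods.PeriodEqualityDecidability
import Literature.Barriers.KontsevichZagierPeriods.AlgebraicPrimitivesObstruction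
import Literature.NumberTheory.Transcendental.SemialgebraicMapsProofs
import Literature.NumberTheory.Transcendental.SemialgebraicMonotonicityDefinable
import Literature.ModelTheory.ExponentialFields.OMinimalEulerFibres
import Literature.ModelTheory.ExponentialFields.OMinimalEulerInvariance
import Literature.ModelTheory.ExponentialFields.RealExpFieldProofs
import Literature.ModelTheory.ExponentialFields.RealClosedFieldTheoryProofs

/-!
# Disproof of `CompleteModGammaSector` (stmt-KontsevichZagierPeriods-14233) — standing adversary, gen 1

**Verdict so far: the crux RESISTS; it cannot be refuted without refuting the summit. No kill.**
Work file of the crux disprover (route TerasomaMultiplication, crux 7; the same item is crux (ii)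
of MotivatedMoves). Prose only in docstrings; every `theorem` below is sorry-free on the standard
axioms (`propext`, `Classical.choice`, `Quot.sound`); there is no NEAR-MISS `sorry` in this file.
It continues the predecessor work file on the retired sup-form sibling `GammaSectorComplete`
(stmt-10378, `Cruxes/GammaSectorComplete/Disproof.lean`), whose §§0–4 are re-proved here for the
subgroup form, and adds §5 (new).

The crux, read back (§0): for every additive subgroup `H` of `FormalRep` with `relations ≤ H`
that contains every Γ-Hodge pair difference `[ρ] − [ρ']` (cube Beta rep minus `2k`-ball × cube
rep, under the Deligne–Koblitz–Ogus test, `c` algebraic, equal values — `PairHyp H`), and for all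
representations `r`, `r'` of KZ's literal shape with `r.value = r'.value`: `[r] − [r'] ∈ H`.
Elaborates (rc 0); no coercion or junk-operator issue (membership in a subgroup of a free abelian
group; `value` is a Bochner integral guarded by the `integrableOn` field; dimension-0 reps are the
constants).

Findings:

1. §0–§1 STRUCTURE. Quantifying over all admissible `H` is quantifying over the least one,
   `sector := relations ⊔ closure (Γ-pairs)`: `completeModGammaSector_iff_sector` (the crux ↔ the
   retired sup form). `of_summit : KontsevichZagierPeriods → crux` (one line), hence
   `summit_false_of_not`: **a kill of this crux is a disproof of Conjecture 1 as formalised**.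
   `gammaHodgeSector_iff_pairHyp_relations : GammaHodgeSector ↔ PairHyp relations` (`Iff.rfl`), so
   under the sibling crux `sector = relations` and the crux IS the summit
   (`iff_summit_of_gammaHodgeSector` = the route's `closes` read both ways). The `H`-interface is
   inhabited by junk (`⊤`) and by the genuine proper model `ker eval` (`admissible_ker_eval`), at
   which the conclusion holds by `hv` (`crux_at_ker_eval`) — all content sits at `H = sector`.
2. §2 KERNEL FORM. `sector ≤ ker eval` and `completeModGammaSector_iff_ker_le : crux ↔ ker eval ≤
   sector` (`…_iff_ker_eq : ↔ ker eval = sector`). A refutation is exactly an element of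
   `ker eval ∖ sector`: an additive invariant of `FormalRep` killing the four move sets AND the
   Γ-pairs and not factoring through `eval`. None is known (Grothendieck–KZ problem itself).
3. §3 LOAD-BEARING HYPOTHESES. value equality: YES (`…_false_without_valueEq`, `[pt,1]`, `[pt,2]`
   at `H = ker eval`). `relations ≤ H`: YES (`…_false_without_relationsLe`: `H = closure(pairs)`
   misses `1 = ∫₀¹dt`, by `ev₀`). Pair hypothesis: dropping it gives EXACTLY the summit
   (`completeModGammaSectorWithoutPairs_iff_summit`) — nothing to refute short of Conjecture 1.
   `IsRational`: NOT load-bearing (`…_iff_withoutRational`).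
4. §4 MOVES, I. Newton–Leibniz is load-bearing even modulo every Γ-pair
   (`…_false_without_newtonLeibniz`, invariant `ev₀` = dimension-0 evaluation; witness
   `[pt,1] − [[0,1],1]`, a TRUE instance: `witness_mem_sector`).
5. §5 MOVES, II (NEW). **Change of variables is load-bearing even modulo every Γ-pair**
   (`completeModGammaSector_false_without_changeOfVariables`). Invariant (`covKer`): push a
   positive-dimensional generator `[σ,f]` to its FIRST coordinate, read the distribution function
   `q ↦ ∫_{σ ∩ {x₀ ≤ q}} f` on the window `q ∈ [2,3]`, modulo `ℝ`-semialgebraic functions of `q`.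
   Rules (1a), (1b) preserve it (`closure_add_le_covKer`, via `KZ.restrictedEval`); rule (3) over a
   base of positive dimension preserves it exactly (`Cdf_eq_of_newtonLeibniz_succ`: localised
   Fubini + FTC, `setIntegral_band_restrict`); rule (3) over the point changes it by the
   SEMIALGEBRAIC `F ∘ clamp − F(a)` (`windowSemialg_Cdf_newtonLeibniz_zero`, Tarski–Seidenberg from
   the tree); every Γ-pair lives over first coordinates `< 1` and changes it by a constant
   (`windowSemialg_Cdf_pair`). The rational pair `r₀ = [[0,1], 1/(2−t)]`, `r₀' = [[2,3], 1/(4−t)]`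
   (`log 2 = log 2`; ONE translation, `witness_mem_changeOfVariablesRel`, so a TRUE instance,
   `witness_cov_mem_sector`) changes it by `log(2 − s) + C`, and `1/(s−2)` has no
   `ℝ`-semialgebraic primitive on `[0,1]` (`noRealSemialgebraicPrimitive_inv_sub_two` — the tree's
   barrier `noSemialgebraicPrimitive_inv_sub_two_holds` re-run over real coefficients). Corollary
   at summit level: rules (1)+(3) alone do not give Conjecture 1
   (`not_periodConjecture_rulesOneThree`). With §4: rules (2) and (3) are mutually independent
   over (1) + Γ-pairs; every proof of the crux uses both, already to translate a domain / to leave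
   dimension 0.
6. §6 MOVES, III (NEW). **Domain additivity (1a) is load-bearing even modulo every Γ-pair —
   modulo van den Dries Ch. 4 (2.4)** (`completeModGammaSector_false_without_domainAdd`; the
   hypothesis `Dries1998_ch4_prop_2_4 Language.orderedRing ℝ` is the tree's named fact, used ONLY
   for rule (2)). Invariant: `ψ [σ,f] = ∫_σ f` if `E(σ)` is even, else `0` (`evenEulerEval`, `E` =
   o-minimal Euler characteristic, tree `eulerChar` + `real_isOMinimal_holds`). (1b): same domain;
   (3): `E(band) = E(base)` (`realEuler_band`, fibre formula, unconditional); (2): `E(Φσ) = E(σ)`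
   (vdD (2.4)); Γ-pairs: BOTH domains have odd `E` — `E((0,1)^N) = (−1)^N`, `E(B^{2k}×(0,1)^{N'})
   = (−1)^{N'}` (`realEuler_ball`: `E(open unit ball of ℝᵈ) = (−1)^d` by the fibre formula,
   `realEuler_ballCube` by `eulerChar_prod`) — so `ψ` kills them unconditionally
   (`pairHyp_ker_evenEulerEval`). Witness `∫_{[0,1]∪[2,3]} 1 = ∫_{[0,2]} 1` (`E = 2` vs `1`, `ψ = 2`;
   a TRUE instance by split + translate + merge, `euler_witness_mem_relations`). Summit-level
   corollary `not_periodConjecture_rulesNoDomainAdd`. TABLE after §§4–6: (1a) load-bearing [mod vdD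
   2.4], (2) load-bearing, (3) load-bearing, each modulo all other rules + the Γ-sector; (1b) is
   derivable from (1a),(2),(3) on paper (split `σ×[0,2]`, bend halves by `t = 1−(1−s)²`,
   `t−1 = (s−1)²`, one NL) — not formalised.
7. §7 MOVES, IV. **Rule (1b) is REDUNDANT** — ALREADY IN THE TREE, in the STRONGER form (1a)+(3):
   `Summit.KontsevichZagierPeriods.Theorems.StuffleInKZ.Negative.Derived.integrandAddRel_subset_closure_domAdd_nl`
   (`integrandAddRel ⊆ closure (domainAddRel ∪ newtonLeibnizRel)`) and `…relations_eq_closure_three_rules`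
   (`Theorems/StuffleInKZ/Negative/IntegrandAdditivityDerived.lean`, cdisprove unit of `StuffleInKZ`;
   found only when my independent six-move derivation below — two slabs, two polynomial bends of the
   last coordinate, one split, one NL move with a `C¹` glued primitive — bounced as a duplicate,
   p84593). §7 is kept as a worked example of rule-(2) bends (its tools landed as
   `Negative/BendMoves.lean`, p83331); cite the survivor, not §7. The same StuffleInKZ unit also has
   the SUMMIT-LEVEL independence of (2) from (1)+(3) (`ChangeOfVariablesFree.lean`: coordinate-swap
   witness, algebraic-shadow-of-the-marginal invariant over `ℚ`) and of (3) from (1)+(2)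
   (`NewtonLeibnizFree.lean`), and lists "(1a) versus (1b)+(2)+(3): open" — settled here by §6
   modulo vdD (2.4). What §§5–6 add beyond that unit: the versions MODULO THE Γ-SECTOR (window
   `[2,3]` + real coefficients make every Γ-pair invisible; odd Euler characteristics of both Γ-pair
   domains), i.e. load-bearing analysis of THIS crux, and a dimension-1 translation witness.
   FINAL TABLE: `{(1a), (2), (3)}` is an irredundant generating set of the moves, even relative to
   the Γ-sector (the (1a)-leg modulo vdD (2.4)); (1b) is redundant given (1a)+(3). For provers: any
   proof of the crux uses (1a), (2) AND (3).
8. WHY IT RESISTS (unchanged diagnosis, sharpened). By §2 a kill is an invariant of the full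
   calculus finer than `eval`; exhibiting one on ANY rational pair refutes the summit (§1). What
   such an invariant cannot be: (i) not local/germ-like and (ii) not absolutely continuous (both
   die under rule (3) between dimensions 1 and 0, as `ev₀` and `Cdf` show from the two sides: `ev₀`
   survives (1),(2) and dies under (3); `Cdf mod semialgebraic` survives (1),(3) and dies under
   (2)); (iii) not a transfer (all data `ℚ`-definable, `ℝ` rigid); (iv) not Dehn/scissors-type
   (`[polytope,1] ~ [pt, vol]` by iterated rule (3)). The §5 invariant is the first in the tree
   that survives Newton–Leibniz; it is killed by the simplest change of variables (a translation),
   and making it translation-invariant (distribution function up to shifts) is killed by dilations,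
   then by general semialgebraic reparametrisations of the first coordinate — under the full rule
   (2) the first coordinate carries no invariant information (any coordinate can be made first).
   Barrier catalogue: `GrothendieckPeriodConjectureDependence*` engaged (crux + GammaHodgeSector =
   summit ⇒ GPC-strength consequences), no refutation handle; `AlgebraicPrimitivesObstruction` USED
   here positively (§5A) as the engine of a negative lemma; `HauptvermutungObstruction`,
   `PeriodEqualityDecidability` not engaged. Small/finite models do not apply (membership in a
   subgroup of the free abelian group on an uncountable type; the only decidable shadow, the Hodge
   test, constrains generators of the sector, not membership).
9. Targets: none handed over (`stuck_stubs = []`, no line picked). Near-misses: none.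

Dependencies reused (all landed): `GammaHodgeSectorNegative.{Admissible, HodgeCondition,
IsCubeBetaRep, IsBallCubeRep, hodge_weight_balance, eq_zero_of_N_eq_zero, intSums_le}`,
`Literature.Barriers.KontsevichZagierPeriods.KZ.{constRep, NoSemialgPrim.*}`, `KZ.IntegralRep.slab`,
`KZ.restrictedEval`, `KZKernelConjectureForms`, `SemialgebraicMapsProofs` (`add/sub/mul_holds`,
`comp_isSemialgebraicMapOn_holds`), `SemialgebraicMonotonicity.isSemialgebraic_real_of`,
`eulerChar` with `eulerChar_cell/union/prod/eq_eulerChar_proj_mul`, `isCell_box`, `real_isOMinimal_holds`,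
`definable_of_isSemialgebraic`, the named fact `Dries1998_ch4_prop_2_4` (hypothesis only).
-/

noncomputable section

set_option linter.dupNamespace false

open MeasureTheory Set
open scoped BigOperators Topology

namespace Summit.KontsevichZagierPeriods.KontsevichZagierPeriods.Cruxes.CompleteModGammaSector.Disproof

open Literature.NumberTheory.Transcendental
open Literature.NumberTheory.Transcendental.KZ
open Summit.KontsevichZagierPeriods.KontsevichZagierPeriods.Theses.TerasomaMultiplication
  (CompleteModGammaSector GammaHodgeSector closes)
open Summit.KontsevichZagierPeriods.GammaHodgeSectorNegative
open Literature.Barriers.KontsevichZagierPeriods.KZ (constRep constRep_value constRep_isRational)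
open Literature.ModelTheory.ExponentialFields (IsSemialgebraic)

/-! ## §0 Vocabulary: the Γ-Hodge pairs and the sector subgroup -/

/-- The generating set of the Γ-sector: the formal differences `[ρ] − [ρ']` of cube Beta
representation and `2k`-ball × cube representation under the Deligne–Koblitz–Ogus hypotheses —
VERBATIM the family quantified in the second hypothesis of `CompleteModGammaSector`.
[cite: Deligne1982HodgeCycles, Thm. 7.18] -/
def gammaHodgePairs : Set FormalRep :=
  {d : FormalRep | ∃ (N N' k : ℕ) (x y : Fin N → ℚ) (x' y' : Fin N' → ℚ) (c : ℝ)
      (ρ : IntegralRep N) (ρ' : IntegralRep (2 * k + N')),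
    (∀ j, 0 < x j ∧ 0 < y j ∧ Int.fract (x j) ≠ 0 ∧ Int.fract (y j) ≠ 0) ∧
    (∀ l, 0 < x' l ∧ 0 < y' l ∧ Int.fract (x' l) ≠ 0 ∧ Int.fract (y' l) ≠ 0) ∧
    (∀ u : ℕ, 0 < u → (∀ j, Nat.Coprime u (x j).den ∧ Nat.Coprime u (y j).den) →
      (∀ l, Nat.Coprime u (x' l).den ∧ Nat.Coprime u (y' l).den) →
      ((∑ j, (Int.fract ((u : ℚ) * x j) + Int.fract ((u : ℚ) * y j) -
          Int.fract ((u : ℚ) * (x j + y j)))) -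
        ∑ l, (Int.fract ((u : ℚ) * x' l) + Int.fract ((u : ℚ) * y' l) -
          Int.fract ((u : ℚ) * (x' l + y' l)))) = (k : ℚ)) ∧
    IsAlgebraic ℚ c ∧
    ρ.domain = {t | ∀ j, t j ∈ Set.Ioo (0:ℝ) 1} ∧
    Set.EqOn ρ.integrand (fun t => ∏ j, (t j) ^ ((x j : ℝ) - 1) * (1 - t j) ^ ((y j : ℝ) - 1))
      ρ.domain ∧
    ρ'.domain = {z | (∑ i : Fin (2 * k), (z (Fin.castAdd N' i)) ^ 2) < 1 ∧
      ∀ l : Fin N', z (Fin.natAdd (2 * k) l) ∈ Set.Ioo (0:ℝ) 1} ∧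
    Set.EqOn ρ'.integrand (fun z => c * (k.factorial : ℝ) *
      ∏ l, (z (Fin.natAdd (2 * k) l)) ^ ((x' l : ℝ) - 1) *
        (1 - z (Fin.natAdd (2 * k) l)) ^ ((y' l : ℝ) - 1)) ρ'.domain ∧
    ρ.value = ρ'.value ∧ d = of ρ - of ρ'}

/-- The Γ-sector subgroup: the moves together with the Γ-Hodge pairs taken as extra axioms — the
SMALLEST subgroup `H` admitted by the hypotheses of the crux. [cite: KontsevichZagier2001, §1.2] -/
def sector : AddSubgroup FormalRep := relations ⊔ AddSubgroup.closure gammaHodgePairs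

/-- Membership in `gammaHodgePairs` in the structured vocabulary of the sibling crux
(`Admissible`, `HodgeCondition`, `IsCubeBetaRep`, `IsBallCubeRep`). [folklore] -/
theorem mem_gammaHodgePairs_iff {d : FormalRep} :
    d ∈ gammaHodgePairs ↔
      ∃ (N N' k : ℕ) (x y : Fin N → ℚ) (x' y' : Fin N' → ℚ) (c : ℝ) (ρ : IntegralRep N)
        (ρ' : IntegralRep (2 * k + N')),
        Admissible x y ∧ Admissible x' y' ∧ HodgeCondition N N' k x y x' y' ∧ IsAlgebraic ℚ c ∧
        IsCubeBetaRep x y ρ ∧ IsBallCubeRep k x' y' c ρ' ∧ ρ.value = ρ'.value ∧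
        d = of ρ - of ρ' := by
  constructor
  · rintro ⟨N, N', k, x, y, x', y', c, ρ, ρ', hx, hx', hH, hc, hd, hi, hd', hi', hv, rfl⟩
    exact ⟨N, N', k, x, y, x', y', c, ρ, ρ', hx, hx', hH, hc, ⟨hd, hi⟩, ⟨hd', hi'⟩, hv, rfl⟩
  · rintro ⟨N, N', k, x, y, x', y', c, ρ, ρ', hx, hx', hH, hc, ⟨hd, hi⟩, ⟨hd', hi'⟩, hv, rfl⟩
    exact ⟨N, N', k, x, y, x', y', c, ρ, ρ', hx, hx', hH, hc, hd, hi, hd', hi', hv, rfl⟩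

/-- A subgroup satisfies the PAIR HYPOTHESIS of the crux (its second hypothesis, verbatim). -/
def PairHyp (H : AddSubgroup FormalRep) : Prop :=
  ∀ (N N' k : ℕ) (x y : Fin N → ℚ) (x' y' : Fin N' → ℚ) (c : ℝ),
    (∀ j, 0 < x j ∧ 0 < y j ∧ Int.fract (x j) ≠ 0 ∧ Int.fract (y j) ≠ 0) →
    (∀ l, 0 < x' l ∧ 0 < y' l ∧ Int.fract (x' l) ≠ 0 ∧ Int.fract (y' l) ≠ 0) →
    (∀ u : ℕ, 0 < u → (∀ j, Nat.Coprime u (x j).den ∧ Nat.Coprime u (y j).den) →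
      (∀ l, Nat.Coprime u (x' l).den ∧ Nat.Coprime u (y' l).den) →
      ((∑ j, (Int.fract ((u : ℚ) * x j) + Int.fract ((u : ℚ) * y j) -
          Int.fract ((u : ℚ) * (x j + y j)))) -
        ∑ l, (Int.fract ((u : ℚ) * x' l) + Int.fract ((u : ℚ) * y' l) -
          Int.fract ((u : ℚ) * (x' l + y' l)))) = (k : ℚ)) →
    IsAlgebraic ℚ c →
    ∀ (ρ : IntegralRep N) (ρ' : IntegralRep (2 * k + N')),
      ρ.domain = {t | ∀ j, t j ∈ Set.Ioo (0:ℝ) 1} →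
      Set.EqOn ρ.integrand (fun t => ∏ j, (t j) ^ ((x j : ℝ) - 1) * (1 - t j) ^ ((y j : ℝ) - 1))
        ρ.domain →
      ρ'.domain = {z | (∑ i : Fin (2 * k), (z (Fin.castAdd N' i)) ^ 2) < 1 ∧
        ∀ l : Fin N', z (Fin.natAdd (2 * k) l) ∈ Set.Ioo (0:ℝ) 1} →
      Set.EqOn ρ'.integrand (fun z => c * (k.factorial : ℝ) *
        ∏ l, (z (Fin.natAdd (2 * k) l)) ^ ((x' l : ℝ) - 1) *
          (1 - z (Fin.natAdd (2 * k) l)) ^ ((y' l : ℝ) - 1)) ρ'.domain →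
      ρ.value = ρ'.value → of ρ - of ρ' ∈ H

/-- The pair hypothesis says exactly `gammaHodgePairs ⊆ H`. [folklore] -/
theorem pairHyp_iff (H : AddSubgroup FormalRep) : PairHyp H ↔ gammaHodgePairs ⊆ (H : Set FormalRep) := by
  constructor
  · rintro h d ⟨N, N', k, x, y, x', y', c, ρ, ρ', hx, hx', hH, hc, hd, hi, hd', hi', hv, rfl⟩
    exact h N N' k x y x' y' c hx hx' hH hc ρ ρ' hd hi hd' hi' hv
  · intro h N N' k x y x' y' c hx hx' hH hc ρ ρ' hd hi hd' hi' hv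
    exact h ⟨N, N', k, x, y, x', y', c, ρ, ρ', hx, hx', hH, hc, hd, hi, hd', hi', hv, rfl⟩

/-- The pair hypothesis says exactly `closure gammaHodgePairs ≤ H`. [folklore] -/
theorem pairHyp_iff_closure_le (H : AddSubgroup FormalRep) :
    PairHyp H ↔ AddSubgroup.closure gammaHodgePairs ≤ H := by
  rw [pairHyp_iff, AddSubgroup.closure_le]

/-- The crux unfolded: the subgroup form, over `PairHyp` (definitional). [folklore] -/
theorem completeModGammaSector_iff_forall :
    CompleteModGammaSector ↔ ∀ H : AddSubgroup FormalRep, relations ≤ H → PairHyp H →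
      ∀ ⦃n m : ℕ⦄ (r : IntegralRep n) (r' : IntegralRep m),
        r.IsRational → r'.IsRational → r.value = r'.value → of r - of r' ∈ H :=
  Iff.rfl

/-- `sector` is admissible: it contains the moves. [folklore] -/
theorem relations_le_sector : relations ≤ sector := le_sup_left

/-- `sector` is admissible: it satisfies the pair hypothesis. [folklore] -/
theorem pairHyp_sector : PairHyp sector :=
  (pairHyp_iff_closure_le _).mpr le_sup_right

/-- `sector` is the SMALLEST admissible subgroup. [folklore] -/
theorem sector_le_of_admissible {H : AddSubgroup FormalRep} (h₁ : relations ≤ H) (h₂ : PairHyp H) :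
    sector ≤ H :=
  sup_le h₁ ((pairHyp_iff_closure_le H).mp h₂)

/-- **Subgroup form = sup form.** The crux is equivalent to Conjecture 1 (rational
two-representation form) with `relations` replaced by `sector = relations ⊔ closure(Γ-pairs)` —
i.e. to the retired sibling `GammaSectorComplete` (stmt-10378): quantifying over all admissible
`H` is quantifying over the least one. [folklore] -/
theorem completeModGammaSector_iff_sector :
    CompleteModGammaSector ↔ ∀ ⦃n m : ℕ⦄ (r : IntegralRep n) (r' : IntegralRep m),
      r.IsRational → r'.IsRational → r.value = r'.value → of r - of r' ∈ sector := by
  constructor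
  · intro h n m r r' hr hr' hv
    exact h sector relations_le_sector pairHyp_sector r r' hr hr' hv
  · intro h H h₁ h₂ n m r r' hr hr' hv
    exact sector_le_of_admissible h₁ h₂ (h r r' hr hr' hv)

/-! ## §1 Structure: the crux is the summit relative to the Γ-sector -/

/-- **The summit implies the crux** (`relations ≤ H`). Hence every refutation of the crux is a
refutation of Conjecture 1 as formalised. [cite: KontsevichZagier2001, §1.2 Conjecture 1] -/
theorem of_summit (h : KontsevichZagierPeriods) : CompleteModGammaSector :=
  fun _ hH _ _ _ r r' hr hr' hv => hH (h r r' hr hr' hv)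

/-- Contrapositive of `of_summit`: `¬ crux → ¬ summit`. [folklore] -/
theorem summit_false_of_not (h : ¬ CompleteModGammaSector) : ¬ KontsevichZagierPeriods :=
  fun hs => h (of_summit hs)

/-- The sibling crux `GammaHodgeSector` says exactly that the Γ-Hodge pairs are already relations:
`GammaHodgeSector ↔ PairHyp relations`. [folklore] -/
theorem gammaHodgeSector_iff_pairHyp_relations : GammaHodgeSector ↔ PairHyp relations :=
  Iff.rfl

/-- `GammaHodgeSector ↔ closure gammaHodgePairs ≤ relations`. [folklore] -/
theorem gammaHodgeSector_iff_closure_le :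
    GammaHodgeSector ↔ AddSubgroup.closure gammaHodgePairs ≤ relations :=
  gammaHodgeSector_iff_pairHyp_relations.trans (pairHyp_iff_closure_le _)

/-- Under the sibling crux the sector collapses to the moves. [folklore] -/
theorem sector_eq_relations_of_gammaHodgeSector (h : GammaHodgeSector) : sector = relations :=
  le_antisymm (sup_le le_rfl (gammaHodgeSector_iff_closure_le.mp h)) le_sup_left

/-- **Given the Γ-sector, the crux IS the summit** (the route's deciding theorem `closes`, read
both ways). [folklore] -/
theorem iff_summit_of_gammaHodgeSector (hΓ : GammaHodgeSector) :
    CompleteModGammaSector ↔ KontsevichZagierPeriods :=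
  ⟨fun h => closes hΓ h, of_summit⟩

/-- NON-VACUITY OF THE INTERFACE: the hypotheses on `H` are satisfiable — by `⊤` (junk) … -/
theorem admissible_top : relations ≤ (⊤ : AddSubgroup FormalRep) ∧ PairHyp ⊤ :=
  ⟨le_top, fun _ _ _ _ _ _ _ _ _ _ _ _ _ _ _ _ _ _ _ => AddSubgroup.mem_top _⟩

/-- Every Γ-Hodge pair evaluates to `0` (its value conjunct). [folklore] -/
theorem closure_gammaHodgePairs_le_ker_eval : AddSubgroup.closure gammaHodgePairs ≤ eval.ker := by
  refine (AddSubgroup.closure_le _).mpr ?_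
  rintro d ⟨N, N', k, x, y, x', y', c, ρ, ρ', -, -, -, -, -, -, -, -, hv, rfl⟩
  show eval (of ρ - of ρ') = 0
  rw [eval_of_sub_of, hv, sub_self]

/-- … and by the PROPER subgroup `ker eval` (a genuine model: soundness of the moves plus the value
conjunct of every pair), at which the crux's conclusion holds outright (`hv`). So the crux's
content sits entirely at the least admissible subgroup `sector`. [cite: KontsevichZagier2001, §1.2] -/
theorem admissible_ker_eval : relations ≤ eval.ker ∧ PairHyp eval.ker :=
  ⟨relations_le_ker_eval_holds,
    (pairHyp_iff_closure_le _).mpr closure_gammaHodgePairs_le_ker_eval⟩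

/-- The instance `H = ker eval` of the crux is TRUE (trivially, by `hv`). [folklore] -/
theorem crux_at_ker_eval ⦃n m : ℕ⦄ (r : IntegralRep n) (r' : IntegralRep m) (hv : r.value = r'.value) :
    of r - of r' ∈ eval.ker := by
  show eval (of r - of r') = 0
  rw [eval_of_sub_of, hv, sub_self]

/-! ## §2 Kernel form: `sector ≤ ker eval`, and the crux says `ker eval ≤ sector` -/

/-- **No evaluation kill**: the whole sector lies in the kernel of evaluation. [cite: KontsevichZagier2001, §1.2] -/
theorem sector_le_ker_eval : sector ≤ eval.ker :=
  sup_le relations_le_ker_eval_holds closure_gammaHodgePairs_le_ker_eval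

/-- Elements of the sector evaluate to `0`. [folklore] -/
theorem eval_eq_zero_of_mem_sector {c : FormalRep} (hc : c ∈ sector) : eval c = 0 :=
  sector_le_ker_eval hc

/-- **Kernel form of the crux**: `CompleteModGammaSector ↔ ker eval ≤ sector` (so, with
`sector_le_ker_eval`, the crux says `ker eval = sector`: evaluation is the ONLY admissible proper
model). A refutation is exactly an element of `ker eval ∖ sector` — an additive invariant of
`FormalRep` killing the four move sets and the Γ-Hodge pairs and not factoring through `eval`.
[cite: KontsevichZagier2001, §1.2 Conjecture 1] [cite: HuberMullerStachPeriods2017, Conj. 13.2.1] -/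
theorem completeModGammaSector_iff_ker_le : CompleteModGammaSector ↔ eval.ker ≤ sector := by
  rw [completeModGammaSector_iff_sector]
  constructor
  · intro h c hc
    have hc0 : eval c = 0 := hc
    obtain ⟨n, m, r, r', hrel⟩ := exists_integralRep_sub_holds c
    obtain ⟨N, R, hR, hrR⟩ := exists_isRational_equivalent_holds r
    obtain ⟨N', R', hR', hrR'⟩ := exists_isRational_equivalent_holds r'
    have hker : eval (c - (of r - of r')) = 0 := relations_le_ker_eval_holds hrel
    rw [map_sub, hc0, zero_sub, neg_eq_zero, eval_of_sub_of, sub_eq_zero] at hker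
    have hv : R.value = R'.value := by
      rw [← Equivalent.value_eq_holds hrR, ← Equivalent.value_eq_holds hrR', hker]
    have hRR' : of R - of R' ∈ sector := h R R' hR hR' hv
    have h1 : of r - of R ∈ sector := AddSubgroup.mem_sup_left hrR
    have h2 : of R' - of r' ∈ sector := AddSubgroup.mem_sup_left hrR'.symm
    have h3 : c - (of r - of r') ∈ sector := AddSubgroup.mem_sup_left hrel
    have hc' : c = (c - (of r - of r')) + ((of r - of R) + (of R - of R') + (of R' - of r')) := by
      abel
    rw [hc']
    exact sector.add_mem h3 (sector.add_mem (sector.add_mem h1 hRR') h2)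
  · intro h n m r r' _ _ hv
    apply h
    show eval (of r - of r') = 0
    rw [eval_of_sub_of, hv, sub_self]

/-- The crux says `ker eval = sector`. [folklore] -/
theorem completeModGammaSector_iff_ker_eq : CompleteModGammaSector ↔ eval.ker = sector := by
  rw [completeModGammaSector_iff_ker_le]
  exact ⟨fun h => le_antisymm h sector_le_ker_eval, fun h => h.le⟩

/-! ## §3 Load-bearing hypotheses -/

/-- The crux with `r.value = r'.value` DROPPED (negative knowledge, not a citable statement). -/
def CompleteModGammaSectorWithoutValueEq : Prop :=
  ∀ H : AddSubgroup FormalRep, relations ≤ H → PairHyp H →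
    ∀ ⦃n m : ℕ⦄ (r : IntegralRep n) (r' : IntegralRep m), r.IsRational → r'.IsRational → of r - of r' ∈ H

/-- **Value equality is load-bearing**: at the admissible `H = ker eval`, `[pt, 1]` and `[pt, 2]`
have KZ's literal shape and `1 − 2 ≠ 0`. [folklore] -/
theorem completeModGammaSector_false_without_valueEq : ¬ CompleteModGammaSectorWithoutValueEq := by
  intro h
  have h0 : eval (of (constRep 1) - of (constRep 2)) = 0 :=
    h _ admissible_ker_eval.1 admissible_ker_eval.2 (constRep 1) (constRep 2)
      (constRep_isRational 1) (constRep_isRational 2)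
  rw [eval_of_sub_of, constRep_value, constRep_value] at h0
  norm_num at h0

/-- The crux with the hypothesis `relations ≤ H` DROPPED (negative knowledge). -/
def CompleteModGammaSectorWithoutRelationsLe : Prop :=
  ∀ H : AddSubgroup FormalRep, PairHyp H →
    ∀ ⦃n m : ℕ⦄ (r : IntegralRep n) (r' : IntegralRep m),
      r.IsRational → r'.IsRational → r.value = r'.value → of r - of r' ∈ H

/-- The crux with the PAIR HYPOTHESIS DROPPED (negative knowledge). -/
def CompleteModGammaSectorWithoutPairs : Prop :=
  ∀ H : AddSubgroup FormalRep, relations ≤ H →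
    ∀ ⦃n m : ℕ⦄ (r : IntegralRep n) (r' : IntegralRep m),
      r.IsRational → r'.IsRational → r.value = r'.value → of r - of r' ∈ H

/-- **Dropping the pair hypothesis gives EXACTLY the summit** (take `H = relations`; conversely
monotonicity): the Γ-pairs are the only thing separating the crux from Conjecture 1 itself, so
there is nothing to refute here short of the summit. [cite: KontsevichZagier2001, §1.2 Conjecture 1] -/
theorem completeModGammaSectorWithoutPairs_iff_summit :
    CompleteModGammaSectorWithoutPairs ↔ KontsevichZagierPeriods :=
  ⟨fun h _ _ r r' hr hr' hv => h relations le_rfl r r' hr hr' hv,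
    fun h _ hH _ _ r r' hr hr' hv => hH (h r r' hr hr' hv)⟩

/-- **The rational shape is NOT load-bearing**: the crux is equivalent to its version for ALL
(`ℚ`-semialgebraic) integral representations (KZ §1.1 remark; tree:
`KZ.exists_isRational_equivalent_holds`). Provers may drop `IsRational` freely.
[cite: KontsevichZagier2001, §1.1 remark after the Definition] -/
theorem completeModGammaSector_iff_withoutRational :
    CompleteModGammaSector ↔
      ∀ H : AddSubgroup FormalRep, relations ≤ H → PairHyp H →
        ∀ ⦃n m : ℕ⦄ (r : IntegralRep n) (r' : IntegralRep m), r.value = r'.value → of r - of r' ∈ H := by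
  constructor
  · intro h H h₁ h₂ n m r r' hv
    exact sector_le_of_admissible h₁ h₂
      (completeModGammaSector_iff_ker_le.mp h (crux_at_ker_eval r r' hv))
  · intro h H h₁ h₂ n m r r' _ _ hv
    exact h H h₁ h₂ r r' hv

/-! ## §4 Which moves bear load modulo the sector, I: Newton–Leibniz (the dimension-0 evaluation `ev₀`) -/

/-- The window family of `ev₀`: everything in dimension `0`, nothing in positive dimension. -/
def dimZeroWindow : (n : ℕ) → Set (Fin n → ℝ)
  | 0 => univ
  | _ + 1 => ∅

/-- The windows are measurable. [folklore] -/
theorem measurableSet_dimZeroWindow : ∀ n, MeasurableSet (dimZeroWindow n)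
  | 0 => MeasurableSet.univ
  | _ + 1 => MeasurableSet.empty

/-- **Dimension-0 evaluation** `ev₀ = KZ.restrictedEval dimZeroWindow`. [folklore] -/
def ev₀ : FormalRep →+ ℝ := restrictedEval dimZeroWindow

/-- `ev₀ [r] = r.value` in dimension `0`. [folklore] -/
theorem ev₀_of_zero (r : IntegralRep 0) : ev₀ (of r) = r.value := by
  simp [ev₀, dimZeroWindow, IntegralRep.value]

/-- `ev₀ [r] = 0` in positive dimension. [folklore] -/
theorem ev₀_of_succ {n : ℕ} (r : IntegralRep (n + 1)) : ev₀ (of r) = 0 := by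
  simp [ev₀, dimZeroWindow]

/-- Index-robust form of `ev₀_of_zero`. [folklore] -/
theorem ev₀_of_eq_value {n : ℕ} (hn : n = 0) (r : IntegralRep n) : ev₀ (of r) = r.value := by
  subst hn
  exact ev₀_of_zero r

/-- Index-robust form of `ev₀_of_succ`. [folklore] -/
theorem ev₀_of_eq_zero {n : ℕ} (hn : n ≠ 0) (r : IntegralRep n) : ev₀ (of r) = 0 := by
  obtain ⟨m, rfl⟩ := Nat.exists_eq_succ_of_ne_zero hn
  exact ev₀_of_succ r

/-- Rules (1a), (1b) preserve `ev₀`. [cite: KontsevichZagier2001, §1.2 rule (1)] -/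
theorem closure_add_le_ker_ev₀ :
    AddSubgroup.closure (domainAddRel ∪ integrandAddRel) ≤ ev₀.ker :=
  closure_add_le_ker_restrictedEval _ measurableSet_dimZeroWindow

/-- Rule (2) preserves `ev₀`. [cite: KontsevichZagier2001, §1.2 rule (2)] -/
theorem ev₀_eq_zero_of_mem_changeOfVariablesRel {c : FormalRep} (hc : c ∈ changeOfVariablesRel) :
    ev₀ c = 0 := by
  have he : eval c = 0 := eval_eq_zero_of_mem_changeOfVariablesRel_holds hc
  obtain ⟨n, r, r', Φ, Φ', -, -, -, -, -, rfl⟩ := hc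
  rcases Nat.eq_zero_or_pos n with hn | hn
  · rw [map_sub, ev₀_of_eq_value hn, ev₀_of_eq_value hn]
    rwa [eval_of_sub_of] at he
  · rw [map_sub, ev₀_of_eq_zero hn.ne', ev₀_of_eq_zero hn.ne', sub_zero]

/-- The subgroup generated by rules (1a), (1b), (2) — everything except Newton–Leibniz. -/
def rulesOneTwo : AddSubgroup FormalRep :=
  AddSubgroup.closure (domainAddRel ∪ integrandAddRel ∪ changeOfVariablesRel)

/-- `rulesOneTwo ≤ relations`. [folklore] -/
theorem rulesOneTwo_le_relations : rulesOneTwo ≤ relations := by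
  unfold rulesOneTwo relations
  exact AddSubgroup.closure_mono Set.subset_union_left

/-- Rules (1), (2) preserve `ev₀`. [cite: KontsevichZagier2001, §1.2] -/
theorem rulesOneTwo_le_ker_ev₀ : rulesOneTwo ≤ ev₀.ker := by
  refine (AddSubgroup.closure_le _).mpr ?_
  rintro c ((hc | hc) | hc)
  · exact closure_add_le_ker_ev₀ (AddSubgroup.subset_closure (Or.inl hc))
  · exact closure_add_le_ker_ev₀ (AddSubgroup.subset_closure (Or.inr hc))
  · exact ev₀_eq_zero_of_mem_changeOfVariablesRel hc

/-- Every Γ-Hodge pair preserves `ev₀` (weight balance `N + I = N' + I' + 2k`: the Γ-sector never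
touches dimension `0` non-trivially). [folklore] -/
theorem ev₀_eq_zero_of_mem_gammaHodgePairs {d : FormalRep} (hd : d ∈ gammaHodgePairs) : ev₀ d = 0 := by
  obtain ⟨N, N', k, x, y, x', y', c, ρ, ρ', hx, hx', hH, -, -, -, hv, rfl⟩ := mem_gammaHodgePairs_iff.mp hd
  rcases Nat.eq_zero_or_pos N with hN | hN
  · subst hN
    obtain ⟨hN', hk⟩ := eq_zero_of_N_eq_zero hx' hH
    have h0 : 2 * k + N' = 0 := by omega
    rw [map_sub, ev₀_of_eq_value rfl ρ, ev₀_of_eq_value h0 ρ', hv, sub_self]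
  · have hb := hodge_weight_balance hx hx' hH
    have hI' := intSums_le x' y'
    have h1 : 2 * k + N' ≠ 0 := by omega
    rw [map_sub, ev₀_of_eq_zero hN.ne' ρ, ev₀_of_eq_zero h1 ρ', sub_zero]

/-- The closure of the Γ-Hodge pairs lies in `ker ev₀`. [folklore] -/
theorem closure_gammaHodgePairs_le_ker_ev₀ : AddSubgroup.closure gammaHodgePairs ≤ ev₀.ker :=
  (AddSubgroup.closure_le _).mpr fun _ hd => ev₀_eq_zero_of_mem_gammaHodgePairs hd

/-- The witness `[[0,1], 1]`: the slab of height one over `[pt, 1]`. -/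
def unitIntervalRep : IntegralRep 1 := (constRep 1).slab 0

/-- `[[0,1], 1]` has KZ's literal (rational) shape. [folklore] -/
theorem unitIntervalRep_isRational : unitIntervalRep.IsRational :=
  ⟨1, 1, fun _ _ => by simp, fun z _ => by simp [unitIntervalRep, constRep]⟩

/-- `[[0,1],1] − [pt,1]` is ONE Newton–Leibniz move. [cite: KontsevichZagier2001, §1.2 rule (3)] -/
theorem of_unitIntervalRep_sub_mem_newtonLeibnizRel :
    of unitIntervalRep - of (constRep 1) ∈ newtonLeibnizRel :=
  (constRep 1).of_slab_sub_of_mem_newtonLeibnizRel 0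

/-- `value [[0,1], 1] = 1`. [folklore] -/
theorem unitIntervalRep_value : unitIntervalRep.value = 1 := by
  have h := Equivalent.value_eq_holds ((constRep 1).equivalent_slab 0)
  rw [constRep_value] at h
  have h' : unitIntervalRep.value = ((1 : ℚ) : ℝ) := h.symm
  rw [h', Rat.cast_one]

/-- `ev₀ ([pt,1] − [[0,1],1]) = 1`. [folklore] -/
theorem ev₀_witness : ev₀ (of (constRep 1) - of unitIntervalRep) = 1 := by
  rw [map_sub, ev₀_of_zero, ev₀_of_eq_zero one_ne_zero unitIntervalRep, sub_zero, constRep_value,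
    Rat.cast_one]

/-- **`relations ≤ H` is load-bearing**: `H = closure (Γ-pairs)` satisfies the pair hypothesis but
misses the rational pair `1 = ∫₀¹ dt` (separated by `ev₀`). [folklore] -/
theorem completeModGammaSector_false_without_relationsLe : ¬ CompleteModGammaSectorWithoutRelationsLe := by
  intro h
  have hmem := h (AddSubgroup.closure gammaHodgePairs) ((pairHyp_iff_closure_le _).mpr le_rfl)
    (constRep 1) unitIntervalRep (constRep_isRational 1) unitIntervalRep_isRational
    (by rw [constRep_value, unitIntervalRep_value, Rat.cast_one])
  have h0 : ev₀ (of (constRep 1) - of unitIntervalRep) = 0 := closure_gammaHodgePairs_le_ker_ev₀ hmem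
  rw [ev₀_witness] at h0
  exact one_ne_zero h0

/-- The crux with `relations` SHRUNK to rules (1), (2) (Newton–Leibniz removed; negative knowledge). -/
def CompleteModGammaSectorWithoutNewtonLeibniz : Prop :=
  ∀ H : AddSubgroup FormalRep, rulesOneTwo ≤ H → PairHyp H →
    ∀ ⦃n m : ℕ⦄ (r : IntegralRep n) (r' : IntegralRep m),
      r.IsRational → r'.IsRational → r.value = r'.value → of r - of r' ∈ H

/-- **Newton–Leibniz is load-bearing even modulo every Γ-Hodge identity**: `H = ker ev₀` contains
rules (1), (2) and all pairs but not `[pt, 1] − [[0,1], 1]`. [folklore] -/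
theorem completeModGammaSector_false_without_newtonLeibniz : ¬ CompleteModGammaSectorWithoutNewtonLeibniz := by
  intro h
  have h0 : ev₀ (of (constRep 1) - of unitIntervalRep) = 0 :=
    h ev₀.ker rulesOneTwo_le_ker_ev₀ ((pairHyp_iff_closure_le _).mpr closure_gammaHodgePairs_le_ker_ev₀)
      (constRep 1) unitIntervalRep (constRep_isRational 1) unitIntervalRep_isRational
      (by rw [constRep_value, unitIntervalRep_value, Rat.cast_one])
  rw [ev₀_witness] at h0
  exact one_ne_zero h0

/-- NON-VACUITY: the witness pair is a TRUE instance of the crux (`[pt,1] − [[0,1],1] ∈ relations`,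
one rule-(3) move), so it refutes only the NL-free strengthening. [folklore] -/
theorem witness_mem_sector : of (constRep 1) - of unitIntervalRep ∈ sector := by
  refine AddSubgroup.mem_sup_left ?_
  have h : of unitIntervalRep - of (constRep 1) ∈ relations :=
    newtonLeibnizRel_subset_relations of_unitIntervalRep_sub_mem_newtonLeibnizRel
  simpa using relations.neg_mem h


/-! ## §5 Which moves bear load modulo the sector, II: CHANGE OF VARIABLES (new this session)

The invariant: push each generator `[σ, f]` of positive dimension forward to its FIRST coordinate and
read the distribution function `q ↦ ∫_{σ ∩ {x₀ ≤ q}} f` on the window `q ∈ [2, 3]`, modulo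
`ℝ`-semialgebraic functions of `q`. Rules (1a), (1b) preserve it exactly; rule (3) over a base of
positive dimension preserves it exactly (the first coordinate is a base coordinate); rule (3) over
the point changes it by `F ∘ clamp − F(a)`, a semialgebraic function; the Γ-pairs live over first
coordinates `< 1` and change it by constants. A translation by `2` of `∫₀¹ dt/(2−t)` changes it by
`log (2 − s) + C` — not semialgebraic. -/

/-! ### §5A The barrier over real coefficients -/

/-- Step (A) of the tree's barrier proof, for an arbitrary coefficient ring `k → ℝ` (verbatim
generalisation of `NoSemialgPrim.exists_ne_zero_isOpen`, which is stated for `k = ℚ`): every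
`k`-semialgebraic subset of `ℝ²` is, off the zero set of some non-zero real polynomial, both open
and closed. [folklore] -/
theorem exists_ne_zero_isOpen_of {k : Type*} [CommRing k] [Algebra k ℝ] {S : Set (Fin 2 → ℝ)}
    (hS : IsSemialgebraic k S) :
    ∃ q : MvPolynomial (Fin 2) ℝ, q ≠ 0 ∧ IsOpen (S ∩ {z | MvPolynomial.eval z q ≠ 0}) ∧
      IsOpen (Sᶜ ∩ {z | MvPolynomial.eval z q ≠ 0}) := by
  have eval_map : ∀ (p : MvPolynomial (Fin 2) k) (z : Fin 2 → ℝ),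
      MvPolynomial.eval z (MvPolynomial.map (algebraMap k ℝ) p) = MvPolynomial.aeval z p := by
    intro p z
    rw [MvPolynomial.eval_map, MvPolynomial.aeval_def]
  unfold Literature.ModelTheory.ExponentialFields.IsSemialgebraic
    Literature.ModelTheory.ExponentialFields.semialgebraicSets at hS
  induction hS using BooleanSubalgebra.closure_bot_sup_induction with
  | mem S hS =>
    rcases hS with ⟨p, rfl⟩ | ⟨p, rfl⟩
    · by_cases hp : MvPolynomial.map (algebraMap k ℝ) p = 0
      · have hall : ∀ z : Fin 2 → ℝ, MvPolynomial.aeval z p = 0 := fun z => by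
          rw [← eval_map, hp, map_zero]
        refine ⟨1, one_ne_zero, ?_, ?_⟩
        · convert isOpen_univ
          ext z
          simp [hall z]
        · convert isOpen_empty
          ext z
          simp [hall z]
      · refine ⟨_, hp, ?_, ?_⟩
        · convert isOpen_empty
          ext z
          simp only [mem_inter_iff, mem_setOf_eq, eval_map, mem_empty_iff_false,
            iff_false, not_and, not_not]
          exact fun h => h
        · convert Literature.Barriers.KontsevichZagierPeriods.KZ.NoSemialgPrim.isOpen_eval_ne_zero
            (MvPolynomial.map (algebraMap k ℝ) p) using 1
          ext z
          simp only [mem_inter_iff, mem_compl_iff, mem_setOf_eq, eval_map]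
          tauto
    · by_cases hp : MvPolynomial.map (algebraMap k ℝ) p = 0
      · have hall : ∀ z : Fin 2 → ℝ, MvPolynomial.aeval z p = 0 := fun z => by
          rw [← eval_map, hp, map_zero]
        refine ⟨1, one_ne_zero, ?_, ?_⟩
        · convert isOpen_empty
          ext z
          simp [hall z]
        · convert isOpen_univ
          ext z
          simp [hall z]
      · refine ⟨_, hp, ?_, ?_⟩
        · have hopen : IsOpen {z : Fin 2 → ℝ | 0 < MvPolynomial.eval z
              (MvPolynomial.map (algebraMap k ℝ) p)} :=
            isOpen_lt continuous_const (MvPolynomial.continuous_eval _)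
          convert hopen using 1
          ext z
          simp only [mem_inter_iff, mem_setOf_eq, eval_map]
          exact ⟨fun h => h.1, fun h => ⟨h, h.ne'⟩⟩
        · have hopen : IsOpen {z : Fin 2 → ℝ | MvPolynomial.eval z
              (MvPolynomial.map (algebraMap k ℝ) p) < 0} :=
            isOpen_lt (MvPolynomial.continuous_eval _) continuous_const
          convert hopen using 1
          ext z
          simp only [mem_inter_iff, mem_compl_iff, mem_setOf_eq, eval_map, not_lt]
          exact ⟨fun h => lt_of_le_of_ne h.1 h.2, fun h => ⟨h.le, h.ne⟩⟩
  | bot =>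
    exact ⟨1, one_ne_zero, by simp, by simp⟩
  | sup S hS T hT ihS ihT =>
    obtain ⟨p, hp, hp1, hp2⟩ := ihS
    obtain ⟨q, hq, hq1, hq2⟩ := ihT
    refine ⟨p * q, mul_ne_zero hp hq, ?_, ?_⟩
    · have : ((S ⊔ T) ∩ {z : Fin 2 → ℝ | MvPolynomial.eval z (p * q) ≠ 0}) =
          (S ∩ {z | MvPolynomial.eval z p ≠ 0}) ∩ {z | MvPolynomial.eval z q ≠ 0} ∪
            (T ∩ {z | MvPolynomial.eval z q ≠ 0}) ∩ {z | MvPolynomial.eval z p ≠ 0} := by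
        ext z
        simp only [sup_eq_union, mem_inter_iff, mem_union, mem_setOf_eq, map_mul, mul_ne_zero_iff]
        tauto
      rw [this]
      exact (hp1.inter (Literature.Barriers.KontsevichZagierPeriods.KZ.NoSemialgPrim.isOpen_eval_ne_zero q)).union
        (hq1.inter (Literature.Barriers.KontsevichZagierPeriods.KZ.NoSemialgPrim.isOpen_eval_ne_zero p))
    · have : ((S ⊔ T)ᶜ ∩ {z : Fin 2 → ℝ | MvPolynomial.eval z (p * q) ≠ 0}) =
          (Sᶜ ∩ {z | MvPolynomial.eval z p ≠ 0}) ∩ (Tᶜ ∩ {z | MvPolynomial.eval z q ≠ 0}) := by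
        ext z
        simp only [sup_eq_union, compl_union, mem_inter_iff, mem_compl_iff, mem_setOf_eq, map_mul,
          mul_ne_zero_iff]
        tauto
      rw [this]
      exact hp2.inter hq2
  | compl S hS ih =>
    obtain ⟨p, hp, h1, h2⟩ := ih
    exact ⟨p, hp, h2, by simpa only [compl_compl] using h1⟩

open Polynomial in
open scoped Polynomial.Bivariate in
/-- **The barrier over REAL coefficients**: no `ℝ`-semialgebraic function on `[0, 1]` (real
parameters allowed) has derivative `1/(t − 2)` on `(0, 1)`. Same proof as the tree's
`noSemialgebraicPrimitive_inv_sub_two_holds` (steps (A)–(D)); only step (A) needed the coefficient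
generalisation `exists_ne_zero_isOpen_of`. [cite: Fresan2024, Rem. 3.6] [cite: Ayoub2015, Rem. 1.2] -/
theorem noRealSemialgebraicPrimitive_inv_sub_two :
    ¬ ∃ F : (Fin 1 → ℝ) → ℝ, IsSemialgebraicFunOn ℝ {x | x 0 ∈ Icc (0 : ℝ) 1} F ∧
      ∀ t ∈ Ioo (0 : ℝ) 1, HasDerivAt (fun s : ℝ => F (fun _ => s)) (1 / (t - 2)) t := by
  rintro ⟨F, hF, hderiv⟩
  set Γ : Set (Fin 2 → ℝ) :=
    {z | ∃ x ∈ {x : Fin 1 → ℝ | x 0 ∈ Icc (0 : ℝ) 1}, z = Fin.snoc x (F x)} with hΓ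
  have hΓ' : IsSemialgebraic ℝ Γ := hF
  obtain ⟨q, hq0, hopen, -⟩ := exists_ne_zero_isOpen_of hΓ'
  have hvan : ∀ z ∈ Γ, MvPolynomial.eval z q = 0 := by
    intro z hz
    by_contra hne
    obtain ⟨ε, hε, hball⟩ := Metric.isOpen_iff.mp hopen z ⟨hz, hne⟩
    obtain ⟨x, hx, rfl⟩ := hz
    have hmem : (Fin.snoc x (F x + ε / 2) : Fin 2 → ℝ) ∈
        Metric.ball (Fin.snoc x (F x) : Fin 2 → ℝ) ε := by
      rw [Metric.mem_ball, dist_pi_lt_iff hε]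
      intro i
      fin_cases i
      · simp [Fin.snoc, hε]
      · simp [Fin.snoc, abs_of_pos hε, half_lt_self hε]
    obtain ⟨⟨x', -, hxx'⟩, -⟩ := hball hmem
    have h0 : x = x' := by
      funext j
      fin_cases j
      simpa [Fin.snoc] using congrFun hxx' 0
    have h1 := congrFun hxx' 1
    simp only [Fin.snoc] at h1
    simp [← h0] at h1
    exact absurd h1 hε.ne'
  set P : ℝ[X][Y] := (Polynomial.Bivariate.equivMvPolynomial ℝ).symm q with hP
  have hP0 : P ≠ 0 := by simpa [hP] using hq0
  have hPv : ∀ t ∈ Ioo (0 : ℝ) 1, P.evalEval t (F fun _ => t) = 0 := by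
    intro t ht
    have hz : (Fin.snoc (fun _ : Fin 1 => t) (F fun _ => t) : Fin 2 → ℝ) ∈ Γ :=
      ⟨fun _ => t, Ioo_subset_Icc_self ht, rfl⟩
    have h := hvan _ hz
    rw [← Literature.Barriers.KontsevichZagierPeriods.KZ.NoSemialgPrim.evalEval_equivMvPolynomial_symm] at h
    simpa [Fin.snoc] using h
  exact hP0 (Literature.Barriers.KontsevichZagierPeriods.KZ.NoSemialgPrim.eq_zero_of_evalEval_eq_zero
    hderiv P.natDegree P le_rfl hPv)

/-! ### §5B The invariant: first-coordinate distribution function modulo ℝ-semialgebraic functions -/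

/-- Window family: the half-space `{x₀ ≤ q}` in positive dimension, nothing in dimension `0`. -/
def halfWindow (q : ℝ) : (n : ℕ) → Set (Fin n → ℝ)
  | 0 => ∅
  | _ + 1 => {x | x 0 ≤ q}

/-- The windows are measurable. [folklore] -/
theorem measurableSet_halfWindow (q : ℝ) : ∀ n, MeasurableSet (halfWindow q n)
  | 0 => MeasurableSet.empty
  | _ + 1 => measurableSet_le (measurable_pi_apply 0) measurable_const

/-- **First-coordinate distribution function** `Cdf c q = restrictedEval (halfWindow q) c`:
on a generator `[σ, f]` of positive dimension, `q ↦ ∫_{σ ∩ {x₀ ≤ q}} f`; `0` in dimension `0`.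
[folklore] -/
def Cdf : FormalRep →+ (ℝ → ℝ) := AddMonoidHom.pi fun q => restrictedEval (halfWindow q)

/-- Pointwise formula. [folklore] -/
theorem Cdf_apply (c : FormalRep) (q : ℝ) : Cdf c q = restrictedEval (halfWindow q) c := rfl

/-- `Cdf` of a positive-dimensional generator. [folklore] -/
theorem Cdf_of_succ {n : ℕ} (r : IntegralRep (n + 1)) (q : ℝ) :
    Cdf (of r) q = ∫ x in r.domain ∩ {x | x 0 ≤ q}, r.integrand x := by
  rw [Cdf_apply, restrictedEval_of]
  rfl

/-- `Cdf` of a dimension-`0` generator vanishes. [folklore] -/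
theorem Cdf_of_zero (r : IntegralRep 0) : Cdf (of r) = 0 := by
  funext q
  rw [Cdf_apply, restrictedEval_of]
  simp [halfWindow]

/-- Index-robust form of `Cdf_of_zero`. [folklore] -/
theorem Cdf_of_eq_zero {n : ℕ} (hn : n = 0) (r : IntegralRep n) : Cdf (of r) = 0 := by
  subst hn
  exact Cdf_of_zero r

/-- Index-robust evaluation: if every point of the domain has first coordinate `≤ q`, then
`Cdf [r] q = r.value`. [folklore] -/
theorem Cdf_of_eq_value {n : ℕ} (hn : 0 < n) (r : IntegralRep n) (q : ℝ)
    (hq : ∀ x ∈ r.domain, x ⟨0, hn⟩ ≤ q) : Cdf (of r) q = r.value := by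
  obtain ⟨m, rfl⟩ := Nat.exists_eq_succ_of_ne_zero hn.ne'
  have hset : r.domain ∩ {x : Fin (m + 1) → ℝ | x 0 ≤ q} = r.domain :=
    inter_eq_left.mpr fun x hx => by simpa using hq x hx
  rw [Cdf_of_succ, IntegralRep.value, hset]

/-- `g` agrees on the window `q = 2 + s`, `s ∈ [0, 1]`, with an `ℝ`-semialgebraic function of `s`. -/
def WindowSemialg (g : ℝ → ℝ) : Prop :=
  ∃ G : (Fin 1 → ℝ) → ℝ, IsSemialgebraicFunOn ℝ {x | x 0 ∈ Icc (0 : ℝ) 1} G ∧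
    ∀ s ∈ Icc (0 : ℝ) 1, g (2 + s) = G (fun _ => s)

/-- The unit interval `[0,1] ⊆ ℝ¹` is `ℝ`-semialgebraic. [folklore] -/
theorem isSemialgebraic_window : IsSemialgebraic ℝ {x : Fin 1 → ℝ | x 0 ∈ Icc (0 : ℝ) 1} := by
  have h : {x : Fin 1 → ℝ | x 0 ∈ Icc (0 : ℝ) 1} =
      {x : Fin 1 → ℝ | MvPolynomial.aeval x (MvPolynomial.C 0 : MvPolynomial (Fin 1) ℝ) ≤
          MvPolynomial.aeval x (MvPolynomial.X 0 : MvPolynomial (Fin 1) ℝ)} ∩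
        {x | MvPolynomial.aeval x (MvPolynomial.X 0 : MvPolynomial (Fin 1) ℝ) ≤
          MvPolynomial.aeval x (MvPolynomial.C 1 : MvPolynomial (Fin 1) ℝ)} := by
    ext x
    simp
  rw [h]
  exact (Literature.ModelTheory.ExponentialFields.isSemialgebraic_setOf_eval_le _ _).inter
    (Literature.ModelTheory.ExponentialFields.isSemialgebraic_setOf_eval_le _ _)

/-- Real constants are `ℝ`-semialgebraic functions on the window. [folklore] -/
theorem windowSemialg_const_fun (c : ℝ) :
    IsSemialgebraicFunOn ℝ {x : Fin 1 → ℝ | x 0 ∈ Icc (0 : ℝ) 1} (fun _ => c) :=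
  (isSemialgebraicFunOn_aeval isSemialgebraic_window (MvPolynomial.C c)).congr fun x _ => by simp

/-- A function constant on the window is window-semialgebraic. [folklore] -/
theorem WindowSemialg.of_const {g : ℝ → ℝ} (c : ℝ) (h : ∀ s ∈ Icc (0 : ℝ) 1, g (2 + s) = c) :
    WindowSemialg g :=
  ⟨fun _ => c, windowSemialg_const_fun c, h⟩

/-- `0` is window-semialgebraic. [folklore] -/
theorem WindowSemialg.zero : WindowSemialg 0 := WindowSemialg.of_const 0 fun _ _ => rfl

/-- Window-semialgebraic functions are closed under addition (Tarski–Seidenberg, tree: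
`IsSemialgebraicFunOn.add_holds`). [folklore] -/
theorem WindowSemialg.add {g h : ℝ → ℝ} (hg : WindowSemialg g) (hh : WindowSemialg h) :
    WindowSemialg (g + h) := by
  obtain ⟨G, hG, hgG⟩ := hg
  obtain ⟨H, hH, hhH⟩ := hh
  refine ⟨G + H, IsSemialgebraicFunOn.add_holds hG hH, fun s hs => ?_⟩
  simp [hgG s hs, hhH s hs]

/-- Window-semialgebraic functions are closed under negation. [folklore] -/
theorem WindowSemialg.neg {g : ℝ → ℝ} (hg : WindowSemialg g) : WindowSemialg (-g) := by
  obtain ⟨G, hG, hgG⟩ := hg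
  refine ⟨-G, hG.neg, fun s hs => ?_⟩
  simp [hgG s hs]

/-- **The invariant subgroup**: formal combinations whose first-coordinate distribution function
is `ℝ`-semialgebraic on the window `[2, 3]`. [folklore] -/
def covKer : AddSubgroup FormalRep where
  carrier := {c | WindowSemialg (Cdf c)}
  zero_mem' := by
    show WindowSemialg (Cdf 0)
    rw [map_zero]
    exact WindowSemialg.zero
  add_mem' := by
    intro a b ha hb
    show WindowSemialg (Cdf (a + b))
    rw [map_add]
    exact WindowSemialg.add ha hb
  neg_mem' := by
    intro a ha
    show WindowSemialg (Cdf (-a))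
    rw [map_neg]
    exact WindowSemialg.neg ha

/-- Membership in `covKer`. [folklore] -/
theorem mem_covKer_iff {c : FormalRep} : c ∈ covKer ↔ WindowSemialg (Cdf c) := Iff.rfl

/-- Rules (1a), (1b) lie in `covKer`: they preserve every restricted evaluation, hence `Cdf`
pointwise (tree: `closure_add_le_ker_restrictedEval`). [cite: KontsevichZagier2001, §1.2 rule (1)] -/
theorem closure_add_le_covKer :
    AddSubgroup.closure (domainAddRel ∪ integrandAddRel) ≤ covKer := by
  intro c hc
  rw [mem_covKer_iff]
  have h0 : Cdf c = 0 := by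
    funext q
    rw [Cdf_apply]
    exact closure_add_le_ker_restrictedEval _ (measurableSet_halfWindow q) hc
  rw [h0]
  exact WindowSemialg.zero

/-! ### §5C Newton–Leibniz over a positive-dimensional base preserves `Cdf` -/

/-- **Restricted soundness of the Newton–Leibniz move.** For a move of rule (3) (band over `τ`
with bounds `a ≤ b` and fibrewise primitive `F`) and ANY measurable set `S` of base points,
`∫_{band ∩ init⁻¹ S} ∂F/∂t = ∫_{τ ∩ S} (F(x,b x) − F(x,a x))` — the tree's soundness computation
(`eval_eq_zero_of_mem_newtonLeibnizRel_holds`: Fubini along the last coordinate + FTC on each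
fibre) localised to `S`; `S` need not be semialgebraic. [cite: KontsevichZagier2001, §1.2 rule (3)] -/
theorem setIntegral_band_restrict {n : ℕ} (r : IntegralRep (n + 1)) (r' : IntegralRep n)
    {a b : (Fin n → ℝ) → ℝ} {F : (Fin (n + 1) → ℝ) → ℝ}
    (hab : ∀ x ∈ r'.domain, a x ≤ b x)
    (hdom : r.domain = {z | (Fin.init z : Fin n → ℝ) ∈ r'.domain ∧ a (Fin.init z) ≤ z (Fin.last n) ∧
      z (Fin.last n) ≤ b (Fin.init z)})
    (hcont : ∀ x ∈ r'.domain, ContinuousOn (fun t : ℝ => F (Fin.snoc x t)) (Icc (a x) (b x)))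
    (hderiv : ∀ x ∈ r'.domain, ∀ t ∈ Ioo (a x) (b x),
      HasDerivAt (fun s : ℝ => F (Fin.snoc x s)) (r.integrand (Fin.snoc x t)) t)
    {S : Set (Fin n → ℝ)} (hS : MeasurableSet S) :
    ∫ z in r.domain ∩ {z | Fin.init z ∈ S}, r.integrand z =
      ∫ x in r'.domain ∩ S, (F (Fin.snoc x (b x)) - F (Fin.snoc x (a x))) := by
  have hτm : MeasurableSet (r'.domain ∩ S) := (IntegralRep.measurableSet_domain_holds r').inter hS
  have hinit : Measurable (Fin.init : (Fin (n + 1) → ℝ) → Fin n → ℝ) :=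
    measurable_pi_lambda _ fun i => measurable_pi_apply _
  have hbm : MeasurableSet (r.domain ∩ {z | Fin.init z ∈ S}) :=
    (IntegralRep.measurableSet_domain_holds r).inter (hS.preimage hinit)
  -- split off the last coordinate
  set e : (Fin (n + 1) → ℝ) ≃ᵐ ℝ × (Fin n → ℝ) :=
    MeasurableEquiv.piFinSuccAbove (fun _ => ℝ) (Fin.last n) with he_def
  have he : MeasurePreserving e volume volume :=
    volume_preserving_piFinSuccAbove (fun _ => ℝ) (Fin.last n)
  have he_symm : ∀ p : ℝ × (Fin n → ℝ), e.symm p = Fin.snoc p.2 p.1 := fun p => by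
    simp [he_def, MeasurableEquiv.piFinSuccAbove, Fin.snocEquiv]
  -- membership in the restricted band, fibrewise
  have hmem : ∀ x t, Fin.snoc x t ∈ r.domain ∩ {z | Fin.init z ∈ S} ↔
      x ∈ r'.domain ∩ S ∧ t ∈ Icc (a x) (b x) := by
    intro x t
    rw [hdom]
    simp only [mem_inter_iff, mem_setOf_eq, Fin.init_snoc, Fin.snoc_last, mem_Icc]
    tauto
  -- the integrand extended by zero off the restricted band, and its fibres
  set G : (Fin (n + 1) → ℝ) → ℝ := (r.domain ∩ {z | Fin.init z ∈ S}).indicator r.integrand with hG_def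
  have hG : Integrable G :=
    (integrable_indicator_iff hbm).mpr (r.integrableOn.mono_set inter_subset_left)
  have hfib_in : ∀ x ∈ r'.domain ∩ S, (fun t => G (Fin.snoc x t)) =
      (Icc (a x) (b x)).indicator (fun t => r.integrand (Fin.snoc x t)) := by
    intro x hx
    ext t
    by_cases ht : t ∈ Icc (a x) (b x)
    · rw [Set.indicator_of_mem ht, hG_def, Set.indicator_of_mem ((hmem x t).2 ⟨hx, ht⟩)]
    · rw [Set.indicator_of_notMem ht, hG_def,
        Set.indicator_of_notMem (fun h => ht ((hmem x t).1 h).2)]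
  have hfib_out : ∀ x ∉ r'.domain ∩ S, (fun t => G (Fin.snoc x t)) = fun _ => 0 := by
    intro x hx
    ext t
    rw [hG_def, Set.indicator_of_notMem (fun h => hx ((hmem x t).1 h).1)]
  have hG2 : Integrable (fun p : ℝ × (Fin n → ℝ) => G (Fin.snoc p.2 p.1))
      ((volume : Measure ℝ).prod (volume : Measure (Fin n → ℝ))) := by
    have h := ((he.symm e).integrable_comp_emb e.symm.measurableEmbedding (g := G)).mpr hG
    rw [← Measure.volume_eq_prod]
    convert h using 1
    ext p
    simp [he_symm]
  calc ∫ z in r.domain ∩ {z | Fin.init z ∈ S}, r.integrand z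
      = ∫ z, G z := (integral_indicator hbm).symm
    _ = ∫ p, G (e.symm p) := ((he.symm e).integral_comp' G).symm
    _ = ∫ p : ℝ × (Fin n → ℝ), G (Fin.snoc p.2 p.1) ∂(volume.prod volume) := by
        simp_rw [he_symm, Measure.volume_eq_prod]
    _ = ∫ x, ∫ t, G (Fin.snoc x t) := integral_prod_symm _ hG2
    _ = ∫ x, (r'.domain ∩ S).indicator
          (fun x => F (Fin.snoc x (b x)) - F (Fin.snoc x (a x))) x := by
        apply integral_congr_ae
        filter_upwards [hG2.prod_left_ae] with x hx
        by_cases hxτ : x ∈ r'.domain ∩ S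
        · rw [Set.indicator_of_mem hxτ, hfib_in x hxτ, integral_indicator measurableSet_Icc,
            integral_Icc_eq_integral_Ioc, ← intervalIntegral.integral_of_le (hab x hxτ.1)]
          apply intervalIntegral.integral_eq_sub_of_hasDerivAt_of_le (hab x hxτ.1) (hcont x hxτ.1)
            (hderiv x hxτ.1)
          rw [intervalIntegrable_iff_integrableOn_Icc_of_le (hab x hxτ.1)]
          have hx' : Integrable (fun t => G (Fin.snoc x t)) := hx
          rw [hfib_in x hxτ] at hx'
          exact (integrable_indicator_iff measurableSet_Icc).mp hx'
        · rw [Set.indicator_of_notMem hxτ]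
          rw [hfib_out x hxτ, integral_zero]
    _ = ∫ x in r'.domain ∩ S, (F (Fin.snoc x (b x)) - F (Fin.snoc x (a x))) :=
        integral_indicator hτm

/-- A Newton–Leibniz move over a base of POSITIVE dimension preserves `Cdf` exactly: the first
coordinate is a base coordinate, so the half-space `{z₀ ≤ q}` is a cylinder over the base.
[cite: KontsevichZagier2001, §1.2 rule (3)] -/
theorem Cdf_eq_of_newtonLeibniz_succ {m : ℕ} (r : IntegralRep (m + 1 + 1)) (r' : IntegralRep (m + 1))
    {a b : (Fin (m + 1) → ℝ) → ℝ} {F : (Fin (m + 1 + 1) → ℝ) → ℝ}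
    (hab : ∀ x ∈ r'.domain, a x ≤ b x)
    (hdom : r.domain = {z | (Fin.init z : Fin (m + 1) → ℝ) ∈ r'.domain ∧
      a (Fin.init z) ≤ z (Fin.last (m + 1)) ∧ z (Fin.last (m + 1)) ≤ b (Fin.init z)})
    (hcont : ∀ x ∈ r'.domain, ContinuousOn (fun t : ℝ => F (Fin.snoc x t)) (Icc (a x) (b x)))
    (hderiv : ∀ x ∈ r'.domain, ∀ t ∈ Ioo (a x) (b x),
      HasDerivAt (fun s : ℝ => F (Fin.snoc x s)) (r.integrand (Fin.snoc x t)) t)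
    (hr' : ∀ x ∈ r'.domain, r'.integrand x = F (Fin.snoc x (b x)) - F (Fin.snoc x (a x))) :
    Cdf (of r) = Cdf (of r') := by
  funext q
  rw [Cdf_of_succ, Cdf_of_succ]
  have hS : MeasurableSet {x : Fin (m + 1) → ℝ | x 0 ≤ q} := measurableSet_halfWindow q (m + 1)
  have hset : r.domain ∩ {z : Fin (m + 1 + 1) → ℝ | z 0 ≤ q} =
      r.domain ∩ {z | Fin.init z ∈ {x : Fin (m + 1) → ℝ | x 0 ≤ q}} := by
    ext z
    simp only [mem_inter_iff, mem_setOf_eq, Fin.init, Fin.castSucc_zero]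
  rw [hset, setIntegral_band_restrict r r' hab hdom hcont hderiv hS]
  exact setIntegral_congr_fun ((IntegralRep.measurableSet_domain_holds r').inter hS)
    fun x hx => (hr' x hx.1).symm

/-! ### §5D Newton–Leibniz over the point (base dimension `0`) is window-semialgebraic -/

/-- Functions on `Fin 1` are determined by their value at `0`. [folklore] -/
theorem fin_one_eq (z : Fin 1 → ℝ) : z = fun _ => z 0 := by
  funext i
  rw [Subsingleton.elim i 0]

/-- `Fin.snoc` over the empty tuple is the constant tuple. [folklore] -/
theorem snoc_fin_zero (x : Fin 0 → ℝ) (t : ℝ) : (Fin.snoc x t : Fin 1 → ℝ) = fun _ => t := by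
  funext i
  have hi : i = Fin.last 0 := Fin.ext (by have := i.isLt; simp only [Fin.val_last]; omega)
  rw [hi, Fin.snoc_last]

/-- `min` through `|·|`. [folklore] -/
theorem min_eq_half (a b : ℝ) : min a b = 1 / 2 * (a + b - |a - b|) := by
  rcases le_total a b with h | h
  · rw [min_eq_left h, abs_of_nonpos (sub_nonpos.mpr h)]
    ring
  · rw [min_eq_right h, abs_of_nonneg (sub_nonneg.mpr h)]
    ring

/-- `max` through `|·|`. [folklore] -/
theorem max_eq_half (a b : ℝ) : max a b = 1 / 2 * (a + b + |a - b|) := by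
  rcases le_total a b with h | h
  · rw [max_eq_right h, abs_of_nonpos (sub_nonpos.mpr h)]
    ring
  · rw [max_eq_left h, abs_of_nonneg (sub_nonneg.mpr h)]
    ring

/-- `min` of real semialgebraic functions is semialgebraic. [cite: BochnakCosteRoy1998, Prop. 2.2.6] -/
theorem IsSemialgebraicFunOn.min' {m : ℕ} {s : Set (Fin m → ℝ)} {f g : (Fin m → ℝ) → ℝ}
    (hf : IsSemialgebraicFunOn ℝ s f) (hg : IsSemialgebraicFunOn ℝ s g) :
    IsSemialgebraicFunOn ℝ s (fun x => min (f x) (g x)) := by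
  have hs : IsSemialgebraic ℝ s := IsSemialgebraicFunOn.isSemialgebraic_holds hf
  have hhalf : IsSemialgebraicFunOn ℝ s (fun _ => (1 / 2 : ℝ)) :=
    (isSemialgebraicFunOn_aeval hs (MvPolynomial.C (1 / 2 : ℝ))).congr fun x _ => by simp
  have h1 : IsSemialgebraicFunOn ℝ s (f - g) := IsSemialgebraicFunOn.sub_holds hf hg
  have h2 : IsSemialgebraicFunOn ℝ s (fun x => |(f - g) x|) := h1.abs
  have h3 : IsSemialgebraicFunOn ℝ s (f + g) := IsSemialgebraicFunOn.add_holds hf hg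
  have h4 : IsSemialgebraicFunOn ℝ s ((f + g) - fun x => |(f - g) x|) := IsSemialgebraicFunOn.sub_holds h3 h2
  have h5 : IsSemialgebraicFunOn ℝ s ((fun _ => (1 / 2 : ℝ)) * ((f + g) - fun x => |(f - g) x|)) :=
    IsSemialgebraicFunOn.mul_holds hhalf h4
  refine h5.congr fun x _ => ?_
  simp only [Pi.mul_apply, Pi.sub_apply, Pi.add_apply, min_eq_half]

/-- `max` of real semialgebraic functions is semialgebraic. [cite: BochnakCosteRoy1998, Prop. 2.2.6] -/
theorem IsSemialgebraicFunOn.max' {m : ℕ} {s : Set (Fin m → ℝ)} {f g : (Fin m → ℝ) → ℝ}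
    (hf : IsSemialgebraicFunOn ℝ s f) (hg : IsSemialgebraicFunOn ℝ s g) :
    IsSemialgebraicFunOn ℝ s (fun x => max (f x) (g x)) := by
  have hs : IsSemialgebraic ℝ s := IsSemialgebraicFunOn.isSemialgebraic_holds hf
  have hhalf : IsSemialgebraicFunOn ℝ s (fun _ => (1 / 2 : ℝ)) :=
    (isSemialgebraicFunOn_aeval hs (MvPolynomial.C (1 / 2 : ℝ))).congr fun x _ => by simp
  have h1 : IsSemialgebraicFunOn ℝ s (f - g) := IsSemialgebraicFunOn.sub_holds hf hg
  have h2 : IsSemialgebraicFunOn ℝ s (fun x => |(f - g) x|) := h1.abs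
  have h3 : IsSemialgebraicFunOn ℝ s (f + g) := IsSemialgebraicFunOn.add_holds hf hg
  have h4 : IsSemialgebraicFunOn ℝ s ((f + g) + fun x => |(f - g) x|) := IsSemialgebraicFunOn.add_holds h3 h2
  have h5 : IsSemialgebraicFunOn ℝ s ((fun _ => (1 / 2 : ℝ)) * ((f + g) + fun x => |(f - g) x|)) :=
    IsSemialgebraicFunOn.mul_holds hhalf h4
  refine h5.congr fun x _ => ?_
  simp only [Pi.mul_apply, Pi.sub_apply, Pi.add_apply, max_eq_half]

/-- **FTC on a clipped band in `ℝ¹`.** For `a₀ ≤ b₀`, an integrand `f` on the band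
`{a₀ ≤ z₀ ≤ b₀}` with a primitive `F₀` (continuous on `[a₀,b₀]`, derivative `f` inside):
`∫_{band ∩ {z₀ ≤ q}} f = F₀ (clamp q) − F₀ a₀`, `clamp q = max a₀ (min q b₀)`. [folklore] -/
theorem setIntegral_band_fin_one {a₀ b₀ : ℝ} {f : (Fin 1 → ℝ) → ℝ} {F₀ : ℝ → ℝ}
    (hab : a₀ ≤ b₀) (hint : IntegrableOn f {z : Fin 1 → ℝ | a₀ ≤ z 0 ∧ z 0 ≤ b₀})
    (hcont : ContinuousOn F₀ (Icc a₀ b₀))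
    (hderiv : ∀ t ∈ Ioo a₀ b₀, HasDerivAt F₀ (f (fun _ => t)) t) (q : ℝ) :
    ∫ z in {z : Fin 1 → ℝ | a₀ ≤ z 0 ∧ z 0 ≤ b₀} ∩ {z | z 0 ≤ q}, f z =
      F₀ (max a₀ (min q b₀)) - F₀ a₀ := by
  rcases lt_or_ge q a₀ with hq | hq
  · have hset : {z : Fin 1 → ℝ | a₀ ≤ z 0 ∧ z 0 ≤ b₀} ∩ {z | z 0 ≤ q} = ∅ := by
      ext z
      simp only [mem_inter_iff, mem_setOf_eq, mem_empty_iff_false, iff_false, not_and]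
      intro h _
      linarith [h.1]
    have hmax : max a₀ (min q b₀) = a₀ := max_eq_left ((min_le_left _ _).trans hq.le)
    rw [hset, Measure.restrict_empty, integral_zero_measure, hmax, sub_self]
  · set m := min q b₀ with hm
    have ham : a₀ ≤ m := le_min hq hab
    have hmb : m ≤ b₀ := min_le_right _ _
    have hmax : max a₀ m = m := max_eq_right ham
    set e := MeasurableEquiv.funUnique (Fin 1) ℝ with he
    have he_apply : ∀ z : Fin 1 → ℝ, e z = z 0 := fun z => rfl
    have hmp : MeasurePreserving e volume volume := volume_preserving_funUnique (Fin 1) ℝ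
    have hset : {z : Fin 1 → ℝ | a₀ ≤ z 0 ∧ z 0 ≤ b₀} ∩ {z | z 0 ≤ q} = e ⁻¹' Icc a₀ m := by
      ext z
      simp only [mem_inter_iff, mem_setOf_eq, mem_preimage, he_apply, mem_Icc, hm, le_min_iff]
      tauto
    have hfz : ∀ z : Fin 1 → ℝ, f z = f (fun _ => e z) := fun z => by
      rw [he_apply]
      exact congrArg f (fin_one_eq z)
    rw [hmax, hset]
    have htrans : ∫ z in e ⁻¹' Icc a₀ m, f z = ∫ t in Icc a₀ m, f (fun _ => t) := by
      rw [← hmp.setIntegral_preimage_emb e.measurableEmbedding (fun t => f fun _ => t) (Icc a₀ m)]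
      exact setIntegral_congr_fun (measurableSet_Icc.preimage e.measurable) fun z _ => hfz z
    rw [htrans, integral_Icc_eq_integral_Ioc, ← intervalIntegral.integral_of_le ham]
    apply intervalIntegral.integral_eq_sub_of_hasDerivAt_of_le ham
      (hcont.mono (Icc_subset_Icc_right hmb)) (fun t ht => hderiv t ⟨ht.1, ht.2.trans_le hmb⟩)
    rw [intervalIntegrable_iff_integrableOn_Icc_of_le ham]
    have h2 : IntegrableOn f (e ⁻¹' Icc a₀ m) := hint.mono_set (by rw [← hset]; exact inter_subset_left)
    have h3 : IntegrableOn ((fun t => f fun _ => t) ∘ e) (e ⁻¹' Icc a₀ m) := by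
      refine h2.congr_fun (fun z _ => hfz z) (measurableSet_Icc.preimage e.measurable)
    exact (hmp.integrableOn_comp_preimage e.measurableEmbedding).mp h3

/-- The window `[0,1] ⊆ ℝ¹` (the variable `s = q − 2`). -/
abbrev window01 : Set (Fin 1 → ℝ) := {x | x 0 ∈ Icc (0 : ℝ) 1}

/-- **A Newton–Leibniz move over the point is window-semialgebraic.** For `r = [[a₀,b₀], F']`,
`r' = [pt, F(b₀) − F(a₀)]`: `Cdf ([r] − [r']) (q) = F (clamp q) − F (a₀)` (FTC on the clipped
band), and `s ↦ F (clamp (2 + s)) − F (a₀)` is `ℝ`-semialgebraic on `[0,1]` (composition of the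
`ℚ`-semialgebraic primitive `F` with the semialgebraic clamp; Tarski–Seidenberg).
[cite: KontsevichZagier2001, §1.2 rule (3)] -/
theorem windowSemialg_Cdf_newtonLeibniz_zero (r : IntegralRep 1) (r' : IntegralRep 0)
    {a b : (Fin 0 → ℝ) → ℝ} {F : (Fin 1 → ℝ) → ℝ}
    (hF : IsSemialgebraicFunOn ℚ r.domain F)
    (hab : ∀ x ∈ r'.domain, a x ≤ b x)
    (hdom : r.domain = {z | (Fin.init z : Fin 0 → ℝ) ∈ r'.domain ∧ a (Fin.init z) ≤ z (Fin.last 0) ∧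
      z (Fin.last 0) ≤ b (Fin.init z)})
    (hcont : ∀ x ∈ r'.domain, ContinuousOn (fun t : ℝ => F (Fin.snoc x t)) (Icc (a x) (b x)))
    (hderiv : ∀ x ∈ r'.domain, ∀ t ∈ Ioo (a x) (b x),
      HasDerivAt (fun s : ℝ => F (Fin.snoc x s)) (r.integrand (Fin.snoc x t)) t) :
    WindowSemialg (Cdf (of r - of r')) := by
  rw [map_sub, Cdf_of_zero, sub_zero]
  set pt : Fin 0 → ℝ := fun i => i.elim0 with hpt
  have hinit : ∀ z : Fin 1 → ℝ, Fin.init z = pt := fun z => Subsingleton.elim _ _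
  by_cases hτ : pt ∈ r'.domain
  · set a₀ := a pt with ha₀
    set b₀ := b pt with hb₀
    have hab₀ : a₀ ≤ b₀ := hab pt hτ
    have hdom' : r.domain = {z : Fin 1 → ℝ | a₀ ≤ z 0 ∧ z 0 ≤ b₀} := by
      rw [hdom]
      ext z
      simp only [mem_setOf_eq, hinit z, hτ, true_and, Fin.last_zero]
      exact Iff.rfl
    set F₀ : ℝ → ℝ := fun t => F (fun _ => t) with hF₀
    have hsnoc : ∀ t : ℝ, (Fin.snoc pt t : Fin 1 → ℝ) = fun _ => t := snoc_fin_zero pt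
    have hcont₀ : ContinuousOn F₀ (Icc a₀ b₀) := by
      have h := hcont pt hτ
      simp only [hsnoc] at h
      exact h
    have hderiv₀ : ∀ t ∈ Ioo a₀ b₀, HasDerivAt F₀ (r.integrand (fun _ => t)) t := by
      intro t ht
      have h := hderiv pt hτ t ht
      simp only [hsnoc] at h
      exact h
    have hint : IntegrableOn r.integrand {z : Fin 1 → ℝ | a₀ ≤ z 0 ∧ z 0 ≤ b₀} :=
      hdom' ▸ r.integrableOn
    have hcdf : ∀ q, Cdf (of r) q = F₀ (max a₀ (min q b₀)) - F₀ a₀ := by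
      intro q
      rw [Cdf_of_succ, hdom']
      exact setIntegral_band_fin_one hab₀ hint hcont₀ hderiv₀ q
    -- semialgebraicity of the clamp composite on the window
    have hW : IsSemialgebraic ℝ window01 := isSemialgebraic_window
    have hu : IsSemialgebraicFunOn ℝ window01 (fun x => 2 + x 0) :=
      (isSemialgebraicFunOn_aeval hW (MvPolynomial.C 2 + MvPolynomial.X 0)).congr fun x _ => by simp
    have hca : IsSemialgebraicFunOn ℝ window01 (fun _ => a₀) := windowSemialg_const_fun a₀
    have hcb : IsSemialgebraicFunOn ℝ window01 (fun _ => b₀) := windowSemialg_const_fun b₀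
    have hclamp : IsSemialgebraicFunOn ℝ window01 (fun x => max a₀ (min (2 + x 0) b₀)) :=
      IsSemialgebraicFunOn.max' hca (IsSemialgebraicFunOn.min' hu hcb)
    set Ψ : (Fin 1 → ℝ) → (Fin 1 → ℝ) := fun x _ => max a₀ (min (2 + x 0) b₀) with hΨ
    have hΨsa : IsSemialgebraicMapOn ℝ window01 Ψ := IsSemialgebraicMapOn.of_forall hW fun _ => hclamp
    have hmaps : MapsTo Ψ window01 {z : Fin 1 → ℝ | a₀ ≤ z 0 ∧ z 0 ≤ b₀} := fun x _ =>
      ⟨le_max_left _ _, max_le hab₀ (min_le_right _ _)⟩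
    have hFℝ : IsSemialgebraicFunOn ℝ {z : Fin 1 → ℝ | a₀ ≤ z 0 ∧ z 0 ≤ b₀} F := by
      rw [hdom'] at hF
      exact SemialgebraicMonotonicity.isSemialgebraic_real_of hF
    have hcomp : IsSemialgebraicFunOn ℝ window01 (F ∘ Ψ) :=
      IsSemialgebraicFunOn.comp_isSemialgebraicMapOn_holds hFℝ hΨsa hmaps
    have hconst : IsSemialgebraicFunOn ℝ window01 (fun _ => F₀ a₀) := windowSemialg_const_fun (F₀ a₀)
    have hG : IsSemialgebraicFunOn ℝ window01 ((F ∘ Ψ) - fun _ => F₀ a₀) :=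
      IsSemialgebraicFunOn.sub_holds hcomp hconst
    refine ⟨(F ∘ Ψ) - fun _ => F₀ a₀, hG, fun s _ => ?_⟩
    rw [hcdf]
    rfl
  · have hdom' : r.domain = ∅ := by
      rw [hdom]
      ext z
      simp [hinit z, hτ]
    have h0 : Cdf (of r) = 0 := by
      funext q
      rw [Cdf_of_succ, hdom']
      simp
    rw [h0]
    exact WindowSemialg.zero

/-! ### §5F The witness: ONE translation, `∫₀¹ dt/(2−t) = ∫₂³ dt/(4−t)` -/

/-- The band `{a ≤ x₀ ≤ b} ⊆ ℝ¹` with rational ends is `ℚ`-semialgebraic. [folklore] -/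
theorem isSemialgebraic_band (a b : ℚ) :
    IsSemialgebraic ℚ {x : Fin 1 → ℝ | (a : ℝ) ≤ x 0 ∧ x 0 ≤ b} := by
  have h : {x : Fin 1 → ℝ | (a : ℝ) ≤ x 0 ∧ x 0 ≤ b} =
      {x : Fin 1 → ℝ | MvPolynomial.aeval x (MvPolynomial.C a : MvPolynomial (Fin 1) ℚ) ≤
          MvPolynomial.aeval x (MvPolynomial.X 0 : MvPolynomial (Fin 1) ℚ)} ∩
        {x | MvPolynomial.aeval x (MvPolynomial.X 0 : MvPolynomial (Fin 1) ℚ) ≤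
          MvPolynomial.aeval x (MvPolynomial.C b : MvPolynomial (Fin 1) ℚ)} := by
    ext x
    simp
  rw [h]
  exact (Literature.ModelTheory.ExponentialFields.isSemialgebraic_setOf_eval_le _ _).inter
    (Literature.ModelTheory.ExponentialFields.isSemialgebraic_setOf_eval_le _ _)

/-- The band `{a ≤ x₀ ≤ b} ⊆ ℝ¹` is compact. [folklore] -/
theorem isCompact_band (a b : ℝ) : IsCompact {x : Fin 1 → ℝ | a ≤ x 0 ∧ x 0 ≤ b} := by
  convert isCompact_univ_pi (fun _ : Fin 1 => (isCompact_Icc : IsCompact (Icc a b))) using 1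
  ext x
  simp [Set.pi, Fin.forall_fin_one]

/-- `1/(c − x₀)` is integrable on the band `[a,b]` when `b < c`. [folklore] -/
theorem integrableOn_inv_sub (a b c : ℚ) (hbc : (b : ℝ) < c) :
    IntegrableOn (fun x : Fin 1 → ℝ =>
      MvPolynomial.aeval x (1 : MvPolynomial (Fin 1) ℚ) /
        MvPolynomial.aeval x (MvPolynomial.C c - MvPolynomial.X 0 : MvPolynomial (Fin 1) ℚ))
      {x : Fin 1 → ℝ | (a : ℝ) ≤ x 0 ∧ x 0 ≤ b} := by
  have hfun : (fun x : Fin 1 → ℝ => MvPolynomial.aeval x (1 : MvPolynomial (Fin 1) ℚ) /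
        MvPolynomial.aeval x (MvPolynomial.C c - MvPolynomial.X 0 : MvPolynomial (Fin 1) ℚ)) =
      fun x => 1 / ((c : ℝ) - x 0) := by
    funext x
    simp
  rw [hfun]
  refine ContinuousOn.integrableOn_compact (isCompact_band _ _) ?_
  refine continuousOn_const.div (continuousOn_const.sub (continuous_apply 0).continuousOn) ?_
  intro x hx
  have : x 0 ≤ b := hx.2
  exact sub_ne_zero.mpr (by intro h; linarith)

/-- The denominator `c − x₀` does not vanish on the band `[a,b]` when `b < c`. [folklore] -/
theorem aeval_sub_ne_zero (a b c : ℚ) (hbc : (b : ℝ) < c) :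
    ∀ x ∈ {x : Fin 1 → ℝ | (a : ℝ) ≤ x 0 ∧ x 0 ≤ b},
      MvPolynomial.aeval x (MvPolynomial.C c - MvPolynomial.X 0 : MvPolynomial (Fin 1) ℚ) ≠ 0 := by
  intro x hx
  have : x 0 ≤ b := hx.2
  simp only [map_sub, MvPolynomial.aeval_C, MvPolynomial.aeval_X, eq_ratCast, ne_eq]
  intro h
  linarith

/-- `r₀ = [[0,1], 1/(2 − t)]` (value `log 2`), of KZ's literal shape. -/
def r₀ : IntegralRep 1 :=
  IntegralRep.ofRational {x : Fin 1 → ℝ | ((0 : ℚ) : ℝ) ≤ x 0 ∧ x 0 ≤ (1 : ℚ)} 1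
    (MvPolynomial.C 2 - MvPolynomial.X 0) (isSemialgebraic_band 0 1)
    (aeval_sub_ne_zero 0 1 2 (by norm_num)) (integrableOn_inv_sub 0 1 2 (by norm_num))

/-- `r₀' = [[2,3], 1/(4 − t)]` (value `log 2`), of KZ's literal shape: the translate of `r₀` by `2`. -/
def r₀' : IntegralRep 1 :=
  IntegralRep.ofRational {x : Fin 1 → ℝ | ((2 : ℚ) : ℝ) ≤ x 0 ∧ x 0 ≤ (3 : ℚ)} 1
    (MvPolynomial.C 4 - MvPolynomial.X 0) (isSemialgebraic_band 2 3)
    (aeval_sub_ne_zero 2 3 4 (by norm_num)) (integrableOn_inv_sub 2 3 4 (by norm_num))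

/-- `r₀` has KZ's literal (rational) shape. [folklore] -/
theorem r₀_isRational : r₀.IsRational := IntegralRep.isRational_ofRational _ _ _ _ _ _

/-- `r₀'` has KZ's literal (rational) shape. [folklore] -/
theorem r₀'_isRational : r₀'.IsRational := IntegralRep.isRational_ofRational _ _ _ _ _ _

/-- The domain of `r₀` is the band `[0,1]`. [folklore] -/
theorem r₀_domain : r₀.domain = {x : Fin 1 → ℝ | (0 : ℝ) ≤ x 0 ∧ x 0 ≤ 1} := by
  show {x : Fin 1 → ℝ | ((0 : ℚ) : ℝ) ≤ x 0 ∧ x 0 ≤ (1 : ℚ)} = _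
  simp

/-- The domain of `r₀'` is the band `[2,3]`. [folklore] -/
theorem r₀'_domain : r₀'.domain = {x : Fin 1 → ℝ | (2 : ℝ) ≤ x 0 ∧ x 0 ≤ 3} := by
  show {x : Fin 1 → ℝ | ((2 : ℚ) : ℝ) ≤ x 0 ∧ x 0 ≤ (3 : ℚ)} = _
  simp

/-- The integrand of `r₀` is `1/(2 − x₀)`. [folklore] -/
theorem r₀_integrand (x : Fin 1 → ℝ) : r₀.integrand x = 1 / (2 - x 0) := by
  show MvPolynomial.aeval x (1 : MvPolynomial (Fin 1) ℚ) /
    MvPolynomial.aeval x (MvPolynomial.C 2 - MvPolynomial.X 0 : MvPolynomial (Fin 1) ℚ) = _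
  simp

/-- The integrand of `r₀'` is `1/(4 − x₀)`. [folklore] -/
theorem r₀'_integrand (x : Fin 1 → ℝ) : r₀'.integrand x = 1 / (4 - x 0) := by
  show MvPolynomial.aeval x (1 : MvPolynomial (Fin 1) ℚ) /
    MvPolynomial.aeval x (MvPolynomial.C 4 - MvPolynomial.X 0 : MvPolynomial (Fin 1) ℚ) = _
  simp

/-- **The witness pair is ONE move of rule (2)**: the translation `t ↦ t + 2` carries
`[[0,1], 1/(2−t)]` to `[[2,3], 1/(4−t)]`. [cite: KontsevichZagier2001, §1.2 rule (2)] -/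
theorem witness_mem_changeOfVariablesRel : of r₀ - of r₀' ∈ changeOfVariablesRel := by
  refine ⟨1, r₀, r₀', fun x => x + fun _ => (2 : ℝ), fun _ => ContinuousLinearMap.id ℝ (Fin 1 → ℝ),
    ?_, ?_, ?_, ?_, ?_, rfl⟩
  · refine (isSemialgebraicMapOn_aeval r₀.isSemialgebraic_domain
      (fun _ => (MvPolynomial.X 0 + MvPolynomial.C 2 : MvPolynomial (Fin 1) ℚ))).congr ?_
    intro x _
    funext j
    rw [Subsingleton.elim j 0]
    simp
  · intro x _
    exact (hasFDerivWithinAt_id x _).add_const _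
  · intro x _ y _ h
    exact add_right_cancel h
  · rw [r₀_domain, r₀'_domain]
    ext y
    simp only [mem_setOf_eq, mem_image]
    constructor
    · rintro ⟨h1, h2⟩
      refine ⟨y - fun _ => (2 : ℝ), ⟨?_, ?_⟩, ?_⟩
      · simp only [Pi.sub_apply]
        linarith
      · simp only [Pi.sub_apply]
        linarith
      · simp
    · rintro ⟨x, ⟨h1, h2⟩, rfl⟩
      simp only [Pi.add_apply]
      constructor <;> linarith
  · intro x _
    rw [r₀_integrand, r₀'_integrand]
    simp only [Pi.add_apply, ContinuousLinearMap.det, ContinuousLinearMap.coe_id, LinearMap.det_id,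
      abs_one, mul_one]
    ring

/-- Hence the witness pair represents the same number (soundness of rule (2)). [folklore] -/
theorem r₀_value_eq : r₀.value = r₀'.value := by
  have h := eval_eq_zero_of_mem_changeOfVariablesRel_holds witness_mem_changeOfVariablesRel
  rwa [eval_of_sub_of, sub_eq_zero] at h

/-- … and is a TRUE instance of the crux: `[r₀] − [r₀'] ∈ relations`. [folklore] -/
theorem witness_mem_relations : of r₀ - of r₀' ∈ relations :=
  changeOfVariablesRel_subset_relations witness_mem_changeOfVariablesRel

/-- `Cdf [r₀]` is constant `= r₀.value` on the window. [folklore] -/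
theorem Cdf_r₀ {s : ℝ} (hs : s ∈ Icc (0 : ℝ) 1) : Cdf (of r₀) (2 + s) = r₀.value := by
  refine Cdf_of_eq_value one_pos r₀ _ fun x hx => ?_
  rw [r₀_domain] at hx
  have h1 : x 0 ≤ 1 := hx.2
  have h0 : (⟨0, one_pos⟩ : Fin 1) = 0 := rfl
  rw [h0]
  linarith [hs.1]

/-- `Cdf [r₀'] (2 + s) = −log (2 − s) + log 2` on the window (FTC with the transcendental
primitive `−log (4 − t)`). [folklore] -/
theorem Cdf_r₀' {s : ℝ} (hs : s ∈ Icc (0 : ℝ) 1) :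
    Cdf (of r₀') (2 + s) = -Real.log (2 - s) + Real.log 2 := by
  have hcont : ContinuousOn (fun t : ℝ => -Real.log (4 - t)) (Icc 2 3) := by
    refine ContinuousOn.neg (ContinuousOn.log (f := fun t : ℝ => 4 - t)
      (continuousOn_const.sub continuousOn_id) ?_)
    intro t ht h
    have h3 : t ≤ 3 := ht.2
    have h' : (4 : ℝ) - t = 0 := h
    linarith
  have hderiv : ∀ t ∈ Ioo (2 : ℝ) 3, HasDerivAt (fun t : ℝ => -Real.log (4 - t))
      (r₀'.integrand (fun _ => t)) t := by
    intro t ht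
    have hi : r₀'.integrand (fun _ => t) = 1 / (4 - t) := r₀'_integrand _
    rw [hi]
    have h4 : (4 : ℝ) - t ≠ 0 := by
      have := ht.2
      linarith
    have h : HasDerivAt (fun t : ℝ => -Real.log (4 - t)) (-((0 - 1) / (4 - t))) t :=
      (((hasDerivAt_const t (4 : ℝ)).sub (hasDerivAt_id t)).log h4).neg
    exact h.congr_deriv (by ring)
  have hint : IntegrableOn r₀'.integrand {z : Fin 1 → ℝ | (2 : ℝ) ≤ z 0 ∧ z 0 ≤ 3} :=
    r₀'_domain ▸ r₀'.integrableOn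
  rw [Cdf_of_succ, r₀'_domain, setIntegral_band_fin_one (by norm_num) hint hcont hderiv (2 + s)]
  have hmin : min (2 + s) (3 : ℝ) = 2 + s := min_eq_left (by linarith [hs.2])
  have hmax : max (2 : ℝ) (2 + s) = 2 + s := max_eq_right (by linarith [hs.1])
  rw [hmin, hmax]
  have h1 : (4 : ℝ) - (2 + s) = 2 - s := by ring
  have h2 : (4 : ℝ) - 2 = 2 := by norm_num
  simp only [h1, h2, sub_neg_eq_add]

/-- **The witness is separated**: `[r₀] − [r₀'] ∉ covKer`, because on the window its
distribution function is `r₀.value + log (2 − s) − log 2`, whose derivative `1/(s − 2)` has no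
`ℝ`-semialgebraic primitive (`noRealSemialgebraicPrimitive_inv_sub_two`). [folklore] -/
theorem witness_not_mem_covKer : of r₀ - of r₀' ∉ covKer := by
  rintro ⟨G, hG, hgG⟩
  have hformula : ∀ s ∈ Icc (0 : ℝ) 1,
      G (fun _ => s) = r₀.value + Real.log (2 - s) - Real.log 2 := by
    intro s hs
    rw [← hgG s hs, map_sub, Pi.sub_apply, Cdf_r₀ hs, Cdf_r₀' hs]
    ring
  refine noRealSemialgebraicPrimitive_inv_sub_two ⟨G, hG, fun t ht => ?_⟩
  have h2 : (2 : ℝ) - t ≠ 0 := by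
    have := ht.2
    intro h
    linarith
  have h2' : t - (2 : ℝ) ≠ 0 := by
    have := ht.2
    intro h
    linarith
  have hd : HasDerivAt (fun s : ℝ => r₀.value + Real.log (2 - s) - Real.log 2)
      (0 + (0 - 1) / (2 - t) - 0) t :=
    ((hasDerivAt_const t _).add (((hasDerivAt_const t (2 : ℝ)).sub (hasDerivAt_id t)).log h2)).sub
      (hasDerivAt_const t _)
  have hval : (0 : ℝ) + (0 - 1) / (2 - t) - 0 = 1 / (t - 2) := by
    field_simp
    ring
  rw [hval] at hd
  refine hd.congr_of_eventuallyEq (Filter.eventuallyEq_of_mem (Icc_mem_nhds ht.1 ht.2) ?_)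
  intro s hs
  exact hformula s hs


/-! ### §5E Every Γ-Hodge pair is window-semialgebraic (indeed constant on the window) -/

/-- **The Γ-sector is invisible to the invariant.** Both representations of a Γ-Hodge pair have
all first coordinates `< 1 ≤ 2`, so on the window `q ∈ [2,3]` their distribution functions are the
constants `ρ.value`, `ρ'.value` (or `0` in dimension `0`): `Cdf ([ρ] − [ρ'])` is constant there.
[folklore] -/
theorem windowSemialg_Cdf_pair {N N' k : ℕ} (ρ : IntegralRep N) (ρ' : IntegralRep (2 * k + N'))
    (hd : ρ.domain = {t | ∀ j, t j ∈ Set.Ioo (0:ℝ) 1})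
    (hd' : ρ'.domain = {z | (∑ i : Fin (2 * k), (z (Fin.castAdd N' i)) ^ 2) < 1 ∧
      ∀ l : Fin N', z (Fin.natAdd (2 * k) l) ∈ Set.Ioo (0:ℝ) 1}) :
    WindowSemialg (Cdf (of ρ - of ρ')) := by
  have h1 : ∃ c₁ : ℝ, ∀ s ∈ Icc (0:ℝ) 1, Cdf (of ρ) (2 + s) = c₁ := by
    rcases Nat.eq_zero_or_pos N with hN | hN
    · exact ⟨0, fun s _ => by rw [Cdf_of_eq_zero hN]; rfl⟩
    · refine ⟨ρ.value, fun s hs => Cdf_of_eq_value hN ρ _ fun x hx => ?_⟩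
      rw [hd] at hx
      have hx1 := (hx ⟨0, hN⟩).2
      linarith [hs.1]
  have h2 : ∃ c₂ : ℝ, ∀ s ∈ Icc (0:ℝ) 1, Cdf (of ρ') (2 + s) = c₂ := by
    rcases Nat.eq_zero_or_pos (2 * k + N') with hN | hN
    · exact ⟨0, fun s _ => by rw [Cdf_of_eq_zero hN]; rfl⟩
    · refine ⟨ρ'.value, fun s hs => Cdf_of_eq_value hN ρ' _ fun z hz => ?_⟩
      rw [hd'] at hz
      obtain ⟨hball, hcube⟩ := hz
      have hz0 : z ⟨0, hN⟩ < 1 := by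
        rcases Nat.eq_zero_or_pos k with hk | hk
        · subst hk
          have hN' : 0 < N' := by omega
          have h := (hcube ⟨0, hN'⟩).2
          have heq : (Fin.natAdd (2 * 0) ⟨0, hN'⟩ : Fin (2 * 0 + N')) = ⟨0, hN⟩ := Fin.ext (by simp)
          rwa [heq] at h
        · have hk2 : 0 < 2 * k := by omega
          have hle : (z (Fin.castAdd N' ⟨0, hk2⟩)) ^ 2 ≤ ∑ i : Fin (2 * k), (z (Fin.castAdd N' i)) ^ 2 :=
            Finset.single_le_sum (f := fun i => (z (Fin.castAdd N' i)) ^ 2) (fun i _ => sq_nonneg _)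
              (Finset.mem_univ _)
          have heq : (Fin.castAdd N' ⟨0, hk2⟩ : Fin (2 * k + N')) = ⟨0, hN⟩ := Fin.ext rfl
          rw [heq] at hle
          have hsq : (z ⟨0, hN⟩) ^ 2 < 1 := lt_of_le_of_lt hle hball
          by_contra hge
          have hge' : 1 ≤ z ⟨0, hN⟩ := not_lt.mp hge
          nlinarith [hsq, hge']
      linarith [hs.1]
  obtain ⟨c₁, hc₁⟩ := h1
  obtain ⟨c₂, hc₂⟩ := h2
  exact WindowSemialg.of_const (c₁ - c₂) fun s hs => by rw [map_sub, Pi.sub_apply, hc₁ s hs, hc₂ s hs]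

/-! ### §5G Assembly: rule (2) is load-bearing modulo rules (1), (3) and every Γ-Hodge pair -/

/-- The subgroup generated by rules (1a), (1b), (3) — everything except change of variables. -/
def rulesOneThree : AddSubgroup FormalRep :=
  AddSubgroup.closure (domainAddRel ∪ integrandAddRel ∪ newtonLeibnizRel)

/-- `rulesOneThree ≤ relations`. [folklore] -/
theorem rulesOneThree_le_relations : rulesOneThree ≤ relations := by
  unfold rulesOneThree relations
  refine AddSubgroup.closure_mono ?_
  rintro c ((hc | hc) | hc)
  · exact Or.inl (Or.inl (Or.inl hc))
  · exact Or.inl (Or.inl (Or.inr hc))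
  · exact Or.inr hc

/-- **Every Newton–Leibniz move lies in `covKer`.** [cite: KontsevichZagier2001, §1.2 rule (3)] -/
theorem newtonLeibnizRel_subset_covKer : newtonLeibnizRel ⊆ (covKer : Set FormalRep) := by
  rintro c ⟨n, r, r', a, b, F, hF, -, -, hab, hdom, hcont, hderiv, hr', rfl⟩
  cases n with
  | zero => exact windowSemialg_Cdf_newtonLeibniz_zero r r' hF hab hdom hcont hderiv
  | succ m =>
    show WindowSemialg (Cdf (of r - of r'))
    rw [map_sub, Cdf_eq_of_newtonLeibniz_succ r r' hab hdom hcont hderiv hr', sub_self]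
    exact WindowSemialg.zero

/-- **Rules (1a), (1b), (3) preserve the invariant.** [folklore] -/
theorem rulesOneThree_le_covKer : rulesOneThree ≤ covKer := by
  refine (AddSubgroup.closure_le _).mpr ?_
  rintro c ((hc | hc) | hc)
  · exact closure_add_le_covKer (AddSubgroup.subset_closure (Or.inl hc))
  · exact closure_add_le_covKer (AddSubgroup.subset_closure (Or.inr hc))
  · exact newtonLeibnizRel_subset_covKer hc

/-- **Every Γ-Hodge pair preserves the invariant**: `covKer` satisfies the pair hypothesis of the
crux (no Hodge test, algebraicity or value equality is even needed — only the shape of the two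
domains). [folklore] -/
theorem pairHyp_covKer : PairHyp covKer := by
  intro N N' k x y x' y' c _ _ _ _ ρ ρ' hd _ hd' _ _
  exact windowSemialg_Cdf_pair ρ ρ' hd hd'

/-- The closure of the Γ-Hodge pairs lies in `covKer`. [folklore] -/
theorem closure_gammaHodgePairs_le_covKer : AddSubgroup.closure gammaHodgePairs ≤ covKer :=
  (pairHyp_iff_closure_le _).mp pairHyp_covKer

/-- The crux with `relations` SHRUNK to rules (1), (3) (change of variables removed; the Γ-Hodge
pairs kept; negative knowledge, not a citable statement). -/
def CompleteModGammaSectorWithoutChangeOfVariables : Prop :=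
  ∀ H : AddSubgroup FormalRep, rulesOneThree ≤ H → PairHyp H →
    ∀ ⦃n m : ℕ⦄ (r : IntegralRep n) (r' : IntegralRep m),
      r.IsRational → r'.IsRational → r.value = r'.value → of r - of r' ∈ H

/-- **CHANGE OF VARIABLES IS LOAD-BEARING, even modulo every Γ-Hodge identity.** The admissible
subgroup `H = covKer` (formal combinations whose first-coordinate distribution function is
`ℝ`-semialgebraic on the window `[2,3]`) contains rules (1a), (1b), (3) and all Γ-Hodge pairs, but
not the rational pair `∫₀¹ dt/(2−t) = ∫₂³ dt/(4−t)` (`= log 2`): its distribution function on the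
window is `log (2 − s) + const`, and `1/(s − 2)` has no semialgebraic primitive (Ayoub–Fresán, the
tree's barrier, here over real coefficients). Any proof of the crux must use rule (2) — already to
TRANSLATE a domain. Dually to `completeModGammaSector_false_without_newtonLeibniz`: rules (2) and
(3) are independent of each other over (1) + Γ-pairs. [cite: Ayoub2015, Rem. 1.2]
[cite: KontsevichZagier2001, §1.2] -/
theorem completeModGammaSector_false_without_changeOfVariables :
    ¬ CompleteModGammaSectorWithoutChangeOfVariables := fun h =>
  witness_not_mem_covKer (h covKer rulesOneThree_le_covKer pairHyp_covKer r₀ r₀' r₀_isRational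
    r₀'_isRational r₀_value_eq)

/-- **Corollary at summit level: rules (1) and (3) alone do not give Conjecture 1** — the
`ℤ`-span of additivity and Newton–Leibniz moves misses the translation pair (a fortiori, without
any Γ-pairs). [cite: KontsevichZagier2001, §1.2 Conjecture 1] -/
theorem not_periodConjecture_rulesOneThree :
    ¬ ∀ ⦃n m : ℕ⦄ (r : IntegralRep n) (r' : IntegralRep m),
      r.IsRational → r'.IsRational → r.value = r'.value → of r - of r' ∈ rulesOneThree := fun h =>
  witness_not_mem_covKer (rulesOneThree_le_covKer (h r₀ r₀' r₀_isRational r₀'_isRational r₀_value_eq))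

/-- NON-VACUITY: the witness pair is a TRUE instance of the crux (`∈ relations ≤ sector`, one
rule-(2) move), so it refutes only the CoV-free strengthening. [folklore] -/
theorem witness_cov_mem_sector : of r₀ - of r₀' ∈ sector :=
  AddSubgroup.mem_sup_left witness_mem_relations


/-! ## §6 Which moves bear load modulo the sector, III: DOMAIN ADDITIVITY (new this session; rule (2)-invariance modulo van den Dries Ch. 4 (2.4))

The invariant: the EULER-PARITY-WEIGHTED EVALUATION `ψ [σ, f] = ∫_σ f` if the o-minimal Euler
characteristic `E(σ)` is even, `0` if odd. Rule (1b) keeps the domain; rule (3) replaces a band by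
its base (`E` equal, fibre formula — unconditional); rule (2) replaces `σ` by an injective
semialgebraic image (`E` equal by van den Dries Ch. 4 (2.4), in the tree only as the named fact
`Dries1998_ch4_prop_2_4`, taken as a hypothesis); values agree by soundness. Both Γ-pair domains have
ODD Euler characteristic (`E((0,1)^N) = (−1)^N`, `E(B^{2k} × (0,1)^{N'}) = (−1)^{N'}` — the open
ball computed by the fibre formula), so `ψ` kills every Γ-pair UNCONDITIONALLY. The rational pair
`∫_{[0,1]∪[2,3]} 1 = ∫_{[0,2]} 1` (`E = 2` vs `E = 1`; three moves: split, translate, merge) has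
`ψ = 2 ≠ 0`. -/

open FirstOrder FirstOrder.Language
open Literature.ModelTheory.ExponentialFields
open Literature.ModelTheory.ExponentialFields.CellDimension
open MvPolynomial (aeval X C)

/-! ### §6A Glue: the o-minimal Euler characteristic of semialgebraic subsets of `ℝⁿ`
(as in `Cruxes/GpcLegendreLemniscatic/Disproof.lean` §8 — `realEuler`, `realEuler_Icc`, the band lemma — re-proved here) -/

/-- The o-minimal Euler characteristic of `S ⊆ ℝⁿ` in the ordered field `ℝ` (tree `eulerChar`).
[cite: Dries1998, Ch. 4 (2.3)] -/
def realEuler (n : ℕ) (S : Set (Fin n → ℝ)) : ℤ := eulerChar Language.orderedRing n S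

/-- `ℝ` is o-minimal (tree theorem `real_isOMinimal_holds`). [cite: Dries1998, Ch. 2 (2.11)] -/
theorem isOMinimal_real : Language.orderedRing.IsOMinimal ℝ := real_isOMinimal_holds

/-- `ℚ`-semialgebraic sets are definable in the ordered field `ℝ`. [cite: BasuPollackRoy2006, §2.5.1] -/
theorem definable_univ_of_isSemialgebraic {n : ℕ} {s : Set (Fin n → ℝ)} (hs : IsSemialgebraic ℚ s) :
    (univ : Set ℝ).Definable Language.orderedRing s :=
  (definable_of_isSemialgebraic hs).mono (subset_univ _)

/-- `<` is definable. [folklore] -/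
theorem definable_lt_real : (univ : Set ℝ).Definable Language.orderedRing {v : Fin 2 → ℝ | v 0 < v 1} := by
  have h := Literature.ModelTheory.ExponentialFields.isSemialgebraic_setOf_eval_pos (k := ℚ) (R := ℝ)
    (X 1 - X 0 : MvPolynomial (Fin 2) ℚ)
  have heq : {x : Fin 2 → ℝ | 0 < aeval x (X 1 - X 0 : MvPolynomial (Fin 2) ℚ)} = {v | v 0 < v 1} := by
    ext v
    simp [sub_pos]
  rw [heq] at h
  exact definable_univ_of_isSemialgebraic h

/-- **`E` of an open box of `ℝᵐ` is `(−1)^m`** (boxes are `(1,…,1)`-cells). [cite: Dries1998, Ch. 4 (2.1)] -/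
theorem realEuler_box {m : ℕ} (a b : Fin m → ℝ) (hab : ∀ i, a i < b i) :
    realEuler m {v | ∀ i, a i < v i ∧ v i < b i} = (-1) ^ m := by
  have hcell := isCell_box (L := Language.orderedRing) (M := ℝ) definable_lt_real a b hab
  rw [realEuler, eulerChar_cell isOMinimal_real definable_lt_real hcell,
    dim_eq_typeDim isOMinimal_real definable_lt_real hcell, typeDim_const_true]

/-- An open box is definable. [folklore] -/
theorem definable_box {m : ℕ} (a b : Fin m → ℝ) (hab : ∀ i, a i < b i) :
    (univ : Set ℝ).Definable Language.orderedRing {v : Fin m → ℝ | ∀ i, a i < v i ∧ v i < b i} :=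
  (isCell_box (L := Language.orderedRing) (M := ℝ) definable_lt_real a b hab).definable definable_lt_real

/-- `E` of an open interval of `ℝ¹` is `−1`. [cite: Dries1998, Ch. 4 (2.1)] -/
theorem realEuler_Ioo {a b : ℝ} (hab : a < b) :
    realEuler 1 {y : Fin 1 → ℝ | a < y 0 ∧ y 0 < b} = -1 := by
  have h := realEuler_box (fun _ : Fin 1 => a) (fun _ => b) (fun _ => hab)
  have hset : {v : Fin 1 → ℝ | ∀ i, (fun _ : Fin 1 => a) i < v i ∧ v i < (fun _ : Fin 1 => b) i} =
      {y : Fin 1 → ℝ | a < y 0 ∧ y 0 < b} := by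
    ext v
    simp [Fin.forall_fin_one]
  rw [hset] at h
  rw [h]
  norm_num

/-- `E` of a point of `ℝ¹` is `1`. [cite: Dries1998, Ch. 4 (2.1)] -/
theorem realEuler_point (c : ℝ) : realEuler 1 {y : Fin 1 → ℝ | y 0 = c} = 1 := by
  have hset : {y : Fin 1 → ℝ | y 0 = c} = {fun _ => c} := by
    ext y
    simp only [mem_setOf_eq, mem_singleton_iff]
    constructor
    · intro h
      funext i
      rw [Fin.fin_one_eq_zero i]
      exact h
    · intro h
      rw [h]
  rw [realEuler, hset, eulerChar_eq_ncard_of_finite isOMinimal_real definable_lt_real (Set.finite_singleton _),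
    Set.ncard_singleton]
  rfl

/-- **`E([a,b]) = 1`** for a closed bounded interval of `ℝ¹` (`a ≤ b`). [cite: Dries1998, Ch. 4 (2.9)] -/
theorem realEuler_Icc {a b : ℝ} (hab : a ≤ b) :
    realEuler 1 {y : Fin 1 → ℝ | a ≤ y 0 ∧ y 0 ≤ b} = 1 := by
  rcases hab.eq_or_lt with rfl | hlt'
  · have hset : {y : Fin 1 → ℝ | a ≤ y 0 ∧ y 0 ≤ a} = {y | y 0 = a} := by
      ext y
      simp only [mem_setOf_eq]
      constructor
      · intro h; exact le_antisymm h.2 h.1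
      · intro h; exact ⟨h.ge, h.le⟩
    rw [hset]
    exact realEuler_point a
  · set P₁ : Set (Fin 1 → ℝ) := {y | y 0 = a} with hP₁
    set I : Set (Fin 1 → ℝ) := {y | a < y 0 ∧ y 0 < b} with hI
    set P₂ : Set (Fin 1 → ℝ) := {y | y 0 = b} with hP₂
    have hset : {y : Fin 1 → ℝ | a ≤ y 0 ∧ y 0 ≤ b} = (P₁ ∪ I) ∪ P₂ := by
      ext y
      simp only [mem_setOf_eq, mem_union, hP₁, hI, hP₂]
      constructor
      · intro h
        rcases h.1.eq_or_lt with h1 | h1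
        · exact Or.inl (Or.inl h1.symm)
        · rcases h.2.eq_or_lt with h2 | h2
          · exact Or.inr h2
          · exact Or.inl (Or.inr ⟨h1, h2⟩)
      · rintro ((h | h) | h)
        · exact ⟨h.symm.le, h ▸ hlt'.le⟩
        · exact ⟨h.1.le, h.2.le⟩
        · exact ⟨h ▸ hlt'.le, h.le⟩
    have hfin : ∀ c : ℝ, ({y : Fin 1 → ℝ | y 0 = c} : Set (Fin 1 → ℝ)).Finite := by
      intro c
      have : ({y : Fin 1 → ℝ | y 0 = c} : Set (Fin 1 → ℝ)) = {fun _ => c} := by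
        ext y; simp only [mem_setOf_eq, mem_singleton_iff]
        constructor
        · intro h; funext i; rw [Fin.fin_one_eq_zero i]; exact h
        · intro h; rw [h]
      rw [this]; exact Set.finite_singleton _
    have hP₁def : (univ : Set ℝ).Definable Language.orderedRing P₁ := definable_of_finite (hfin a)
    have hP₂def : (univ : Set ℝ).Definable Language.orderedRing P₂ := definable_of_finite (hfin b)
    have hIdef : (univ : Set ℝ).Definable Language.orderedRing I := by
      have h := definable_box (fun _ : Fin 1 => a) (fun _ => b) (fun _ => hlt')
      have hIset : {v : Fin 1 → ℝ | ∀ i, (fun _ : Fin 1 => a) i < v i ∧ v i < (fun _ : Fin 1 => b) i} = I := by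
        ext v
        simp [hI, Fin.forall_fin_one]
      rwa [hIset] at h
    have hd1 : Disjoint P₁ I := Set.disjoint_left.mpr fun y hy hyI => by
      simp only [hP₁, mem_setOf_eq] at hy
      simp only [hI, mem_setOf_eq] at hyI
      linarith [hyI.1]
    have hd2 : Disjoint (P₁ ∪ I) P₂ := Set.disjoint_left.mpr fun y hy hyP => by
      simp only [hP₂, mem_setOf_eq] at hyP
      rcases hy with hy | hy
      · simp only [hP₁, mem_setOf_eq] at hy; linarith
      · simp only [hI, mem_setOf_eq] at hy; linarith [hy.2]
    rw [hset, realEuler, eulerChar_union isOMinimal_real definable_lt_real (hP₁def.union hIdef) hP₂def hd2,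
      eulerChar_union isOMinimal_real definable_lt_real hP₁def hIdef hd1]
    have e1 := realEuler_point a
    have e2 := realEuler_Ioo hlt'
    have e3 := realEuler_point b
    simp only [realEuler] at e1 e2 e3
    rw [e1, e2, e3]
    norm_num

/-- `Fin.init (Fin.append x y) = x` for `y : Fin 1 → ℝ`. [folklore] -/
theorem init_append_one {n : ℕ} (x : Fin n → ℝ) (y : Fin 1 → ℝ) :
    Fin.init (Fin.append x y : Fin (n + 1) → ℝ) = x := by
  funext i
  exact Fin.append_left x y i

/-- `(Fin.append x y) (Fin.last n) = y 0` for `y : Fin 1 → ℝ`. [folklore] -/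
theorem append_last_one {n : ℕ} (x : Fin n → ℝ) (y : Fin 1 → ℝ) :
    (Fin.append x y : Fin (n + 1) → ℝ) (Fin.last n) = y 0 := by
  rw [show Fin.last n = Fin.natAdd n (0 : Fin 1) from Fin.ext (by simp)]
  exact Fin.append_right x y 0

/-- **A Newton–Leibniz band has the Euler characteristic of its base** (fibre formula with closed
bounded fibres `[a x, b x]`, `E = 1`). [cite: Dries1998, Ch. 4 (2.11)] -/
theorem realEuler_band {n : ℕ} (r : IntegralRep (n + 1)) (r' : IntegralRep n)
    {a b : (Fin n → ℝ) → ℝ} (hab : ∀ x ∈ r'.domain, a x ≤ b x)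
    (hdom : r.domain = {z | (Fin.init z : Fin n → ℝ) ∈ r'.domain ∧ a (Fin.init z) ≤ z (Fin.last n) ∧
      z (Fin.last n) ≤ b (Fin.init z)}) :
    realEuler (n + 1) r.domain = realEuler n r'.domain := by
  rw [realEuler, realEuler]
  have hS : (univ : Set ℝ).Definable Language.orderedRing r.domain :=
    definable_univ_of_isSemialgebraic r.isSemialgebraic_domain
  have hfib : ∀ x : Fin n → ℝ, {y : Fin 1 → ℝ | Fin.append x y ∈ r.domain} =
      {y | x ∈ r'.domain ∧ a x ≤ y 0 ∧ y 0 ≤ b x} := by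
    intro x
    ext y
    rw [mem_setOf_eq, hdom, mem_setOf_eq, init_append_one, append_last_one]
    rfl
  have hproj : {x : Fin n → ℝ | ∃ y : Fin 1 → ℝ, Fin.append x y ∈ r.domain} = r'.domain := by
    ext x
    simp only [mem_setOf_eq]
    constructor
    · rintro ⟨y, hy⟩
      have h : y ∈ {y : Fin 1 → ℝ | Fin.append x y ∈ r.domain} := hy
      rw [hfib x] at h
      exact h.1
    · intro hx
      refine ⟨fun _ => a x, ?_⟩
      have h : (fun _ : Fin 1 => a x) ∈ {y : Fin 1 → ℝ | Fin.append x y ∈ r.domain} := by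
        rw [hfib x]
        exact ⟨hx, le_rfl, hab x hx⟩
      exact h
  rw [eulerChar_eq_eulerChar_proj_mul isOMinimal_real definable_lt_real hS (e := 1) fun x ⟨y, hy⟩ => ?_,
    hproj, mul_one]
  have hx : x ∈ r'.domain := by
    have h : y ∈ {y : Fin 1 → ℝ | Fin.append x y ∈ r.domain} := hy
    rw [hfib x] at h
    exact h.1
  rw [hfib x]
  have hset : {y : Fin 1 → ℝ | x ∈ r'.domain ∧ a x ≤ y 0 ∧ y 0 ≤ b x} = {y | a x ≤ y 0 ∧ y 0 ≤ b x} := by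
    ext y
    simp only [mem_setOf_eq]
    exact ⟨fun h => h.2, fun h => ⟨hx, h⟩⟩
  rw [hset]
  exact realEuler_Icc (hab x hx)

/-! ### §6B `E` of the open unit ball and of the Γ-pair domains (new) -/

/-- The open unit ball of `ℝᵈ`. -/
def ball (d : ℕ) : Set (Fin d → ℝ) := {x | ∑ i, x i ^ 2 < 1}

/-- The open unit ball is `ℚ`-semialgebraic. [folklore] -/
theorem isSemialgebraic_ball (d : ℕ) : IsSemialgebraic ℚ (ball d) := by
  have h := Literature.ModelTheory.ExponentialFields.isSemialgebraic_setOf_eval_pos (k := ℚ) (R := ℝ)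
    (1 - ∑ i : Fin d, X i ^ 2 : MvPolynomial (Fin d) ℚ)
  convert h using 1
  ext x
  simp [ball, sub_pos]

/-- **`E(open unit ball of ℝᵈ) = (−1)^d`** (fibre formula: over the ball of `ℝᵈ` the fibres of
the ball of `ℝ^{d+1}` are open intervals). [cite: Dries1998, Ch. 4 (2.11)] -/
theorem realEuler_ball : ∀ d : ℕ, realEuler d (ball d) = (-1) ^ d
  | 0 => by
    have h := realEuler_box (m := 0) Fin.elim0 Fin.elim0 (fun i => i.elim0)
    have hset : {v : Fin 0 → ℝ | ∀ i, Fin.elim0 i < v i ∧ v i < Fin.elim0 i} = ball 0 := by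
      ext v
      simp [ball]
    rwa [hset] at h
  | d + 1 => by
    have hS : (univ : Set ℝ).Definable Language.orderedRing (ball (d + 1)) :=
      definable_univ_of_isSemialgebraic (isSemialgebraic_ball _)
    have hmem : ∀ (a : Fin d → ℝ) (y : Fin 1 → ℝ),
        Fin.append a y ∈ ball (d + 1) ↔ (∑ i, a i ^ 2) + y 0 ^ 2 < 1 := by
      intro a y
      simp only [ball, mem_setOf_eq, Fin.sum_univ_add, Fin.append_left, Fin.append_right,
        Fin.sum_univ_one]
    have hproj : {a : Fin d → ℝ | ∃ y : Fin 1 → ℝ, Fin.append a y ∈ ball (d + 1)} = ball d := by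
      ext a
      simp only [mem_setOf_eq, hmem]
      constructor
      · rintro ⟨y, hy⟩
        have := sq_nonneg (y 0)
        show ∑ i, a i ^ 2 < 1
        linarith
      · intro ha
        refine ⟨fun _ => 0, ?_⟩
        have ha' : ∑ i, a i ^ 2 < 1 := ha
        simpa using ha'
    rw [realEuler, eulerChar_eq_eulerChar_proj_mul isOMinimal_real definable_lt_real hS (e := -1)
      fun a ⟨y, hy⟩ => ?_, hproj]
    · have h := realEuler_ball d
      rw [realEuler] at h
      rw [h, pow_succ]
    · have hs : ∑ i, a i ^ 2 < 1 := by
        have h := (hmem a y).1 hy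
        have := sq_nonneg (y 0)
        linarith
      set c := 1 - ∑ i, a i ^ 2 with hc
      have hcpos : 0 < c := by rw [hc]; linarith
      have hset : {y : Fin 1 → ℝ | Fin.append a y ∈ ball (d + 1)} =
          {y | -Real.sqrt c < y 0 ∧ y 0 < Real.sqrt c} := by
        ext y
        rw [mem_setOf_eq, hmem, mem_setOf_eq, ← Real.sq_lt, hc]
        constructor <;> intro h <;> linarith
      rw [hset]
      have hlt : -Real.sqrt c < Real.sqrt c := by
        have := Real.sqrt_pos.mpr hcpos
        linarith
      exact realEuler_Ioo hlt

/-- `E` of the open unit cube `(0,1)^N` is `(−1)^N`. [cite: Dries1998, Ch. 4 (2.1)] -/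
theorem realEuler_cube (N : ℕ) : realEuler N {t : Fin N → ℝ | ∀ j, t j ∈ Set.Ioo (0:ℝ) 1} = (-1) ^ N :=
  realEuler_box (fun _ => 0) (fun _ => 1) (fun _ => zero_lt_one)

/-- **`E(B^{2k} × (0,1)^{N'}) = (−1)^{2k} · (−1)^{N'}`** (product formula, tree `eulerChar_prod`).
[cite: Dries1998, Ch. 4 (2.11)] -/
theorem realEuler_ballCube (k N' : ℕ) :
    realEuler (2 * k + N') {z : Fin (2 * k + N') → ℝ | (∑ i : Fin (2 * k), (z (Fin.castAdd N' i)) ^ 2) < 1 ∧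
      ∀ l : Fin N', z (Fin.natAdd (2 * k) l) ∈ Set.Ioo (0:ℝ) 1} = (-1) ^ (2 * k) * (-1) ^ N' := by
  have hA : (univ : Set ℝ).Definable Language.orderedRing (ball (2 * k)) :=
    definable_univ_of_isSemialgebraic (isSemialgebraic_ball _)
  have hB : (univ : Set ℝ).Definable Language.orderedRing {t : Fin N' → ℝ | ∀ j, t j ∈ Set.Ioo (0:ℝ) 1} :=
    definable_box (fun _ => 0) (fun _ => 1) (fun _ => zero_lt_one)
  have h := eulerChar_prod isOMinimal_real definable_lt_real hA hB
  have hb := realEuler_ball (2 * k)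
  have hc := realEuler_cube N'
  rw [realEuler] at hb hc
  rw [hb, hc] at h
  rw [realEuler, ← h]
  rfl

/-- The Euler characteristics of both Γ-pair domains are ODD. [folklore] -/
theorem odd_realEuler_cube (N : ℕ) : Odd (realEuler N {t : Fin N → ℝ | ∀ j, t j ∈ Set.Ioo (0:ℝ) 1}) := by
  rw [realEuler_cube]
  exact odd_neg_one.pow

/-- `E(B^{2k} × (0,1)^{N'})` is odd. [folklore] -/
theorem odd_realEuler_ballCube (k N' : ℕ) :
    Odd (realEuler (2 * k + N') {z : Fin (2 * k + N') → ℝ | (∑ i : Fin (2 * k), (z (Fin.castAdd N' i)) ^ 2) < 1 ∧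
      ∀ l : Fin N', z (Fin.natAdd (2 * k) l) ∈ Set.Ioo (0:ℝ) 1}) := by
  rw [realEuler_ballCube]
  exact odd_neg_one.pow.mul odd_neg_one.pow

/-! ### §6C The invariant: Euler-parity-weighted evaluation `ψ` -/

/-- **Euler-parity-weighted evaluation**: `ψ [σ, f] = ∫_σ f` if `E(σ)` is even, `0` if odd.
[folklore] -/
def evenEulerEval : FormalRep →+ ℝ :=
  FreeAbelianGroup.lift fun p => if Even (realEuler p.1 p.2.domain) then p.2.value else 0

/-- `ψ` of a generator. [folklore] -/
theorem evenEulerEval_of {n : ℕ} (r : IntegralRep n) :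
    evenEulerEval (of r) = if Even (realEuler n r.domain) then r.value else 0 :=
  FreeAbelianGroup.lift_apply_of _ _

/-- Rule (1b) preserves `ψ` (same domain; soundness of (1b)). [cite: KontsevichZagier2001, §1.2 rule (1)] -/
theorem evenEulerEval_eq_zero_of_mem_integrandAddRel {c : FormalRep} (hc : c ∈ integrandAddRel) :
    evenEulerEval c = 0 := by
  have he : eval c = 0 := eval_eq_zero_of_mem_integrandAddRel_holds hc
  obtain ⟨n, r, r₁, r₂, h₁, h₂, -, rfl⟩ := hc
  simp only [map_sub, eval_of] at he
  simp only [map_sub, evenEulerEval_of, h₁, h₂]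
  split_ifs <;> linarith

/-- Rule (3) preserves `ψ` (`E(band) = E(base)`; soundness of (3)). [cite: KontsevichZagier2001, §1.2 rule (3)] -/
theorem evenEulerEval_eq_zero_of_mem_newtonLeibnizRel {c : FormalRep} (hc : c ∈ newtonLeibnizRel) :
    evenEulerEval c = 0 := by
  have he : eval c = 0 := eval_eq_zero_of_mem_newtonLeibnizRel_holds hc
  obtain ⟨n, r, r', a, b, F, -, -, -, hab, hdom, -, -, -, rfl⟩ := hc
  simp only [map_sub, eval_of] at he
  simp only [map_sub, evenEulerEval_of, realEuler_band r r' hab hdom]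
  split_ifs <;> linarith

/-- Rule (2) preserves `ψ` MODULO van den Dries Ch. 4 (2.4) (`E(Φ σ) = E(σ)` for an injective
semialgebraic `Φ`; soundness of (2)). [cite: Dries1998, Ch. 4 (2.4)] -/
theorem evenEulerEval_eq_zero_of_mem_changeOfVariablesRel
    (hE : Dries1998_ch4_prop_2_4 Language.orderedRing ℝ) {c : FormalRep}
    (hc : c ∈ changeOfVariablesRel) : evenEulerEval c = 0 := by
  have he : eval c = 0 := eval_eq_zero_of_mem_changeOfVariablesRel_holds hc
  obtain ⟨n, r, r', Φ, Φ', h1, -, h3, h4, -, rfl⟩ := hc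
  simp only [map_sub, eval_of] at he
  have hEq : realEuler n r'.domain = realEuler n r.domain := by
    rw [realEuler, realEuler, h4]
    exact hE isOMinimal_real definable_lt_real r.domain Φ (definable_univ_of_isSemialgebraic h1) h3
  simp only [map_sub, evenEulerEval_of, hEq]
  split_ifs <;> linarith

/-- **Every Γ-Hodge pair preserves `ψ` UNCONDITIONALLY**: both domains have odd Euler
characteristic (`(−1)^N` and `(−1)^{2k}(−1)^{N'}`), so `ψ` vanishes on each representation
separately. [folklore] -/
theorem evenEulerEval_pair {N N' k : ℕ} (ρ : IntegralRep N) (ρ' : IntegralRep (2 * k + N'))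
    (hd : ρ.domain = {t | ∀ j, t j ∈ Set.Ioo (0:ℝ) 1})
    (hd' : ρ'.domain = {z | (∑ i : Fin (2 * k), (z (Fin.castAdd N' i)) ^ 2) < 1 ∧
      ∀ l : Fin N', z (Fin.natAdd (2 * k) l) ∈ Set.Ioo (0:ℝ) 1}) :
    evenEulerEval (of ρ - of ρ') = 0 := by
  have h1 : ¬ Even (realEuler N ρ.domain) := by
    rw [hd, Int.not_even_iff_odd]
    exact odd_realEuler_cube N
  have h2 : ¬ Even (realEuler (2 * k + N') ρ'.domain) := by
    rw [hd', Int.not_even_iff_odd]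
    exact odd_realEuler_ballCube k N'
  rw [map_sub, evenEulerEval_of, evenEulerEval_of, if_neg h1, if_neg h2, sub_self]

/-- The subgroup generated by rules (1b), (2), (3) — everything except DOMAIN additivity. -/
def rulesNoDomainAdd : AddSubgroup FormalRep :=
  AddSubgroup.closure (integrandAddRel ∪ changeOfVariablesRel ∪ newtonLeibnizRel)

/-- `rulesNoDomainAdd ≤ relations`. [folklore] -/
theorem rulesNoDomainAdd_le_relations : rulesNoDomainAdd ≤ relations := by
  unfold rulesNoDomainAdd relations
  refine AddSubgroup.closure_mono ?_
  rintro c ((hc | hc) | hc)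
  · exact Or.inl (Or.inl (Or.inr hc))
  · exact Or.inl (Or.inr hc)
  · exact Or.inr hc

/-- Rules (1b), (2), (3) preserve `ψ` (modulo (2.4) for rule (2)). [folklore] -/
theorem rulesNoDomainAdd_le_ker (hE : Dries1998_ch4_prop_2_4 Language.orderedRing ℝ) :
    rulesNoDomainAdd ≤ evenEulerEval.ker := by
  refine (AddSubgroup.closure_le _).mpr ?_
  rintro c ((hc | hc) | hc)
  · exact evenEulerEval_eq_zero_of_mem_integrandAddRel hc
  · exact evenEulerEval_eq_zero_of_mem_changeOfVariablesRel hE hc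
  · exact evenEulerEval_eq_zero_of_mem_newtonLeibnizRel hc

/-! ### §6D The witness: `∫_{[0,1]∪[2,3]} 1 = ∫_{[0,2]} 1` -/

/-- The band `{a ≤ x₀ ≤ b} ⊆ ℝ¹` with rational ends. -/
def qband (a b : ℚ) : Set (Fin 1 → ℝ) := {x | (a : ℝ) ≤ x 0 ∧ x 0 ≤ b}

/-- Bands are `ℚ`-semialgebraic. [folklore] -/
theorem isSemialgebraic_qband (a b : ℚ) : IsSemialgebraic ℚ (qband a b) := by
  have h : qband a b =
      {x : Fin 1 → ℝ | aeval x (C a : MvPolynomial (Fin 1) ℚ) ≤ aeval x (X 0 : MvPolynomial (Fin 1) ℚ)} ∩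
        {x | aeval x (X 0 : MvPolynomial (Fin 1) ℚ) ≤ aeval x (C b : MvPolynomial (Fin 1) ℚ)} := by
    ext x
    simp [qband]
  rw [h]
  exact (Literature.ModelTheory.ExponentialFields.isSemialgebraic_setOf_eval_le _ _).inter
    (Literature.ModelTheory.ExponentialFields.isSemialgebraic_setOf_eval_le _ _)

/-- Bands are compact. [folklore] -/
theorem isCompact_qband (a b : ℚ) : IsCompact (qband a b) := by
  convert isCompact_univ_pi (fun _ : Fin 1 => (isCompact_Icc : IsCompact (Icc (a : ℝ) b))) using 1
  ext x
  simp [qband, Set.pi, Fin.forall_fin_one]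

/-- The constant-`1` representation over a compact `ℚ`-semialgebraic domain of `ℝ¹`. -/
def constOneRep (σ : Set (Fin 1 → ℝ)) (hσ : IsSemialgebraic ℚ σ) (hc : IsCompact σ) : IntegralRep 1 where
  domain := σ
  integrand := fun _ => 1
  isSemialgebraic_domain := hσ
  isSemialgebraicFunOn_integrand := (isSemialgebraicFunOn_aeval hσ (1 : MvPolynomial (Fin 1) ℚ)).congr
    fun x _ => by simp
  integrableOn := continuousOn_const.integrableOn_compact hc

/-- `constOneRep` has KZ's literal shape (`p = q = 1`). [folklore] -/
theorem constOneRep_isRational (σ : Set (Fin 1 → ℝ)) (hσ : IsSemialgebraic ℚ σ) (hc : IsCompact σ) :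
    (constOneRep σ hσ hc).IsRational :=
  ⟨1, 1, fun _ _ => by simp, fun x _ => by simp [constOneRep]⟩

/-- `r₁ = [[0,1] ∪ [2,3], 1]` (value `2`, Euler characteristic `2`). -/
def twoIntervalsRep : IntegralRep 1 :=
  constOneRep (qband 0 1 ∪ qband 2 3) ((isSemialgebraic_qband 0 1).union (isSemialgebraic_qband 2 3))
    ((isCompact_qband 0 1).union (isCompact_qband 2 3))

/-- `r₁' = [[0,2], 1]` (value `2`, Euler characteristic `1`). -/
def oneIntervalRep : IntegralRep 1 := constOneRep (qband 0 2) (isSemialgebraic_qband 0 2) (isCompact_qband 0 2)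

/-- `[[0,1], 1]`. -/
def band01Rep : IntegralRep 1 := constOneRep (qband 0 1) (isSemialgebraic_qband 0 1) (isCompact_qband 0 1)
/-- `[[2,3], 1]`. -/
def band23Rep : IntegralRep 1 := constOneRep (qband 2 3) (isSemialgebraic_qband 2 3) (isCompact_qband 2 3)
/-- `[[1,2], 1]`. -/
def band12Rep : IntegralRep 1 := constOneRep (qband 1 2) (isSemialgebraic_qband 1 2) (isCompact_qband 1 2)

/-- Split `[0,1] ∪ [2,3]` (disjoint pieces): one move of rule (1a). [cite: KontsevichZagier2001, §1.2 rule (1)] -/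
theorem split_mem_domainAddRel : of twoIntervalsRep - of band01Rep - of band23Rep ∈ domainAddRel := by
  refine ⟨1, twoIntervalsRep, band01Rep, band23Rep, rfl, ?_, fun _ _ => rfl, fun _ _ => rfl, rfl⟩
  have h : (band01Rep.domain ∩ band23Rep.domain : Set (Fin 1 → ℝ)) = ∅ := by
    ext x
    simp only [mem_inter_iff, mem_empty_iff_false, iff_false, not_and]
    intro h1 h2
    have := h1.2
    have := h2.1
    simp only [band01Rep, band23Rep, constOneRep, qband, Rat.cast_one, Rat.cast_ofNat] at *
    linarith
  rw [h, measure_empty]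

/-- Merge `[0,1] ∪ [1,2] = [0,2]` (overlap `{1}` is null): one move of rule (1a). [cite: KontsevichZagier2001, §1.2 rule (1)] -/
theorem merge_mem_domainAddRel : of oneIntervalRep - of band01Rep - of band12Rep ∈ domainAddRel := by
  refine ⟨1, oneIntervalRep, band01Rep, band12Rep, ?_, ?_, fun _ _ => rfl, fun _ _ => rfl, rfl⟩
  · show qband 0 2 = qband 0 1 ∪ qband 1 2
    ext x
    simp only [qband, mem_union, mem_setOf_eq, Rat.cast_zero, Rat.cast_one, Rat.cast_ofNat]
    constructor
    · intro h
      rcases le_total (x 0) 1 with h1 | h1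
      · exact Or.inl ⟨h.1, h1⟩
      · exact Or.inr ⟨h1, h.2⟩
    · rintro (h | h) <;> constructor <;> linarith [h.1, h.2]
  · have hsub : (band01Rep.domain ∩ band12Rep.domain : Set (Fin 1 → ℝ)) ⊆
        (MeasurableEquiv.funUnique (Fin 1) ℝ) ⁻¹' {(1 : ℝ)} := by
      intro x hx
      have h1 : x 0 ≤ 1 := by simpa [band01Rep, constOneRep, qband] using hx.1.2
      have h2 : (1 : ℝ) ≤ x 0 := by simpa [band12Rep, constOneRep, qband] using hx.2.1
      show x 0 ∈ ({(1 : ℝ)} : Set ℝ)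
      exact mem_singleton_iff.mpr (le_antisymm h1 h2)
    refine measure_mono_null hsub ?_
    have h : volume ((MeasurableEquiv.funUnique (Fin 1) ℝ) ⁻¹' {(1 : ℝ)}) = volume ({(1 : ℝ)} : Set ℝ) :=
      (volume_preserving_funUnique (Fin 1) ℝ).measure_preimage_equiv _
    rw [h]
    exact Real.volume_singleton

/-- Translate `[2,3] → [1,2]`: one move of rule (2). [cite: KontsevichZagier2001, §1.2 rule (2)] -/
theorem translate_mem_changeOfVariablesRel : of band23Rep - of band12Rep ∈ changeOfVariablesRel := by
  refine ⟨1, band23Rep, band12Rep, fun x => x + fun _ => (-1 : ℝ), fun _ => ContinuousLinearMap.id ℝ (Fin 1 → ℝ),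
    ?_, ?_, ?_, ?_, ?_, rfl⟩
  · refine (isSemialgebraicMapOn_aeval band23Rep.isSemialgebraic_domain
      (fun _ => (X 0 + C (-1) : MvPolynomial (Fin 1) ℚ))).congr ?_
    intro x _
    funext j
    rw [Subsingleton.elim j 0]
    simp
  · intro x _
    exact (hasFDerivWithinAt_id x _).add_const _
  · intro x _ y _ h
    exact add_right_cancel h
  · show qband 1 2 = (fun x => x + fun _ => (-1 : ℝ)) '' qband 2 3
    ext y
    simp only [qband, mem_setOf_eq, mem_image, Rat.cast_one, Rat.cast_ofNat]
    constructor
    · rintro ⟨h1, h2⟩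
      refine ⟨y - fun _ => (-1 : ℝ), ⟨?_, ?_⟩, ?_⟩
      · simp only [Pi.sub_apply]
        linarith
      · simp only [Pi.sub_apply]
        linarith
      · simp
    · rintro ⟨x, ⟨h1, h2⟩, rfl⟩
      simp only [Pi.add_apply]
      constructor <;> linarith
  · intro x _
    simp [band23Rep, band12Rep, constOneRep, ContinuousLinearMap.det]

/-- **The witness pair is a TRUE instance**: `[r₁] − [r₁'] ∈ relations` (two moves of rule (1a)
and one translation). [folklore] -/
theorem euler_witness_mem_relations : of twoIntervalsRep - of oneIntervalRep ∈ relations := by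
  have h1 : of twoIntervalsRep - of band01Rep - of band23Rep ∈ relations :=
    domainAddRel_subset_relations split_mem_domainAddRel
  have h2 : of oneIntervalRep - of band01Rep - of band12Rep ∈ relations :=
    domainAddRel_subset_relations merge_mem_domainAddRel
  have h3 : of band23Rep - of band12Rep ∈ relations :=
    changeOfVariablesRel_subset_relations translate_mem_changeOfVariablesRel
  have heq : of twoIntervalsRep - of oneIntervalRep =
      (of twoIntervalsRep - of band01Rep - of band23Rep) + (of band23Rep - of band12Rep) -
        (of oneIntervalRep - of band01Rep - of band12Rep) := by abel
  rw [heq]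
  exact relations.sub_mem (relations.add_mem h1 h3) h2

/-- Hence equal values. [folklore] -/
theorem euler_witness_value_eq : twoIntervalsRep.value = oneIntervalRep.value := by
  have h := relations_le_ker_eval_holds euler_witness_mem_relations
  rwa [AddMonoidHom.mem_ker, eval_of_sub_of, sub_eq_zero] at h

/-- `value [[0,2], 1] = 2`. [folklore] -/
theorem oneIntervalRep_value : oneIntervalRep.value = 2 := by
  show ∫ x in qband 0 2, (fun _ : Fin 1 → ℝ => (1 : ℝ)) x = 2
  rw [setIntegral_const]
  have hset : qband 0 2 = (MeasurableEquiv.funUnique (Fin 1) ℝ) ⁻¹' Icc (0 : ℝ) 2 := by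
    ext x
    simp [qband, MeasurableEquiv.funUnique, Fin.default_eq_zero]
  have h : volume ((MeasurableEquiv.funUnique (Fin 1) ℝ) ⁻¹' Icc (0 : ℝ) 2) = volume (Icc (0 : ℝ) 2) :=
    (volume_preserving_funUnique (Fin 1) ℝ).measure_preimage_equiv _
  rw [Measure.real, hset, h, Real.volume_Icc]
  norm_num

/-- `E([0,1] ∪ [2,3]) = 2`. [cite: Dries1998, Ch. 4 (2.9)] -/
theorem realEuler_twoIntervals : realEuler 1 twoIntervalsRep.domain = 2 := by
  show realEuler 1 (qband 0 1 ∪ qband 2 3) = 2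
  have hd : Disjoint (qband 0 1) (qband 2 3) := Set.disjoint_left.mpr fun x h1 h2 => by
    have := h1.2
    have := h2.1
    simp only [qband, Rat.cast_one, Rat.cast_ofNat] at *
    linarith
  rw [realEuler, eulerChar_union isOMinimal_real definable_lt_real
    (definable_univ_of_isSemialgebraic (isSemialgebraic_qband 0 1))
    (definable_univ_of_isSemialgebraic (isSemialgebraic_qband 2 3)) hd]
  have e1 := realEuler_Icc (a := ((0 : ℚ) : ℝ)) (b := ((1 : ℚ) : ℝ)) (by norm_num)
  have e2 := realEuler_Icc (a := ((2 : ℚ) : ℝ)) (b := ((3 : ℚ) : ℝ)) (by norm_num)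
  simp only [realEuler] at e1 e2
  change eulerChar Language.orderedRing 1 (qband 0 1) + eulerChar Language.orderedRing 1 (qband 2 3) = 2
  rw [show qband 0 1 = {y : Fin 1 → ℝ | ((0 : ℚ) : ℝ) ≤ y 0 ∧ y 0 ≤ ((1 : ℚ) : ℝ)} from rfl, e1,
    show qband 2 3 = {y : Fin 1 → ℝ | ((2 : ℚ) : ℝ) ≤ y 0 ∧ y 0 ≤ ((3 : ℚ) : ℝ)} from rfl, e2]
  norm_num

/-- `E([0,2]) = 1`. [cite: Dries1998, Ch. 4 (2.9)] -/
theorem realEuler_oneInterval : realEuler 1 oneIntervalRep.domain = 1 :=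
  realEuler_Icc (a := ((0 : ℚ) : ℝ)) (b := ((2 : ℚ) : ℝ)) (by norm_num)

/-- **`ψ` separates the witness**: `ψ ([r₁] − [r₁']) = 2 − 0 = 2`. [folklore] -/
theorem evenEulerEval_witness : evenEulerEval (of twoIntervalsRep - of oneIntervalRep) = 2 := by
  have h1 : Even (realEuler 1 twoIntervalsRep.domain) := by rw [realEuler_twoIntervals]; exact even_two
  have h2 : ¬ Even (realEuler 1 oneIntervalRep.domain) := by
    rw [realEuler_oneInterval, Int.not_even_iff_odd]; exact odd_one
  rw [map_sub, evenEulerEval_of, evenEulerEval_of, if_pos h1, if_neg h2, sub_zero,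
    euler_witness_value_eq, oneIntervalRep_value]

/-- **DOMAIN ADDITIVITY IS LOAD-BEARING at summit level (modulo vdD (2.4))**: rules (1b), (2), (3)
do not connect `∫_{[0,1]∪[2,3]} 1` and `∫_{[0,2]} 1`. [cite: Dries1998, Ch. 4 (2.4)] -/
theorem witness_not_mem_rulesNoDomainAdd (hE : Dries1998_ch4_prop_2_4 Language.orderedRing ℝ) :
    of twoIntervalsRep - of oneIntervalRep ∉ rulesNoDomainAdd := by
  intro h
  have h0 := rulesNoDomainAdd_le_ker hE h
  rw [AddMonoidHom.mem_ker, evenEulerEval_witness] at h0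
  norm_num at h0


/-! ### §6 assembly: rule (1a) is load-bearing modulo rules (1b), (2), (3) and every Γ-Hodge pair -/

/-- **Every Γ-Hodge pair lies in `ker ψ`** (unconditionally). [folklore] -/
theorem pairHyp_ker_evenEulerEval : PairHyp evenEulerEval.ker := by
  intro N N' k x y x' y' c _ _ _ _ ρ ρ' hd _ hd' _ _
  exact evenEulerEval_pair ρ ρ' hd hd'

/-- The crux with `relations` SHRUNK to rules (1b), (2), (3) (DOMAIN additivity removed; the
Γ-Hodge pairs kept; negative knowledge, not a citable statement). -/
def CompleteModGammaSectorWithoutDomainAdd : Prop :=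
  ∀ H : AddSubgroup FormalRep, rulesNoDomainAdd ≤ H → PairHyp H →
    ∀ ⦃n m : ℕ⦄ (r : IntegralRep n) (r' : IntegralRep m),
      r.IsRational → r'.IsRational → r.value = r'.value → of r - of r' ∈ H

/-- **DOMAIN ADDITIVITY IS LOAD-BEARING, even modulo every Γ-Hodge identity — modulo van den Dries
Ch. 4 (2.4)** (invariance of the o-minimal Euler characteristic under injective definable maps,
tree fact `Dries1998_ch4_prop_2_4`, used only for rule (2)). `H = ker ψ` contains rules (1b), (2),
(3) and all Γ-pairs but not `∫_{[0,1]∪[2,3]} 1 − ∫_{[0,2]} 1`. With §§4–5: each of the rules (1a),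
(2), (3) is independent of the other rules plus the Γ-sector; only (1b) remains (it is derivable
from (1a), (2), (3) on paper: split `σ × [0,2]`, bend each half by `t = 1 − (1−s)²`,
`t − 1 = (s−1)²`, one Newton–Leibniz move). [cite: Dries1998, Ch. 4 (2.4)] -/
theorem completeModGammaSector_false_without_domainAdd
    (hE : Dries1998_ch4_prop_2_4 Language.orderedRing ℝ) : ¬ CompleteModGammaSectorWithoutDomainAdd := by
  intro h
  have h0 := h evenEulerEval.ker (rulesNoDomainAdd_le_ker hE) pairHyp_ker_evenEulerEval
    twoIntervalsRep oneIntervalRep (constOneRep_isRational _ _ _) (constOneRep_isRational _ _ _)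
    euler_witness_value_eq
  rw [AddMonoidHom.mem_ker, evenEulerEval_witness] at h0
  norm_num at h0

/-- **Corollary at summit level (modulo vdD (2.4)): rules (1b), (2), (3) alone do not give
Conjecture 1.** [cite: KontsevichZagier2001, §1.2 Conjecture 1] -/
theorem not_periodConjecture_rulesNoDomainAdd (hE : Dries1998_ch4_prop_2_4 Language.orderedRing ℝ) :
    ¬ ∀ ⦃n m : ℕ⦄ (r : IntegralRep n) (r' : IntegralRep m),
      r.IsRational → r'.IsRational → r.value = r'.value → of r - of r' ∈ rulesNoDomainAdd := fun h =>
  witness_not_mem_rulesNoDomainAdd hE (h twoIntervalsRep oneIntervalRep (constOneRep_isRational _ _ _)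
    (constOneRep_isRational _ _ _) euler_witness_value_eq)

/-- NON-VACUITY: the Euler witness pair is a TRUE instance of the crux (`∈ relations ≤ sector`).
[folklore] -/
theorem euler_witness_mem_sector : of twoIntervalsRep - of oneIntervalRep ∈ sector :=
  AddSubgroup.mem_sup_left euler_witness_mem_relations


/-! ## §7 The remaining rule: (1b) is REDUNDANT — integrand additivity is derivable from (1a), (2), (3)
(worked example; the STRONGER tree fact `integrandAddRel ⊆ closure (domainAddRel ∪ newtonLeibnizRel)`
is `Summit.KontsevichZagierPeriods.Theorems.StuffleInKZ.Negative.Derived.integrandAddRel_subset_closure_domAdd_nl`,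
with `relations_eq_closure_three_rules` — CITE THOSE; this section's landing bounced as a duplicate, p84593)

Every generator `[σ, f+g] − [σ, f] − [σ, g]` is a signed sum of six moves: two slabs (rule 3),
two bends of the last coordinate (rule 2: `s ↦ 2s − s²` on `σ×[0,1]`, `s ↦ 1 + (s−1)²` on
`σ×[1,2]`), one split at `s = 1` (rule 1a), one Newton–Leibniz move on `σ × [0,2]` with the `C¹`
glued primitive. Hence `relations = closure (1a ∪ 2 ∪ 3)` (`relations_eq_closure_three`): with
§§4–6, `{(1a), (2), (3)}` is an IRREDUNDANT generating set of the moves (the (1a)-leg modulo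
vdD (2.4)), even relative to the Γ-sector. -/

section RuleOneB

variable {n : ℕ}

/-! ### §7A Bands, bends, the glued integrand -/

/-! ### Bands over a base -/

/-- The band `σ × [a, b] ⊆ ℝⁿ⁺¹` in the format of the Newton–Leibniz move. -/
def bandSet (σ : Set (Fin n → ℝ)) (a b : ℝ) : Set (Fin (n + 1) → ℝ) :=
  {z | Fin.init z ∈ σ ∧ a ≤ z (Fin.last n) ∧ z (Fin.last n) ≤ b}

/-- Bands with natural-number ends are `ℚ`-semialgebraic. [folklore] -/
theorem isSemialgebraic_bandSet {σ : Set (Fin n → ℝ)} (hσ : IsSemialgebraic ℚ σ) (a b : ℕ) :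
    IsSemialgebraic ℚ (bandSet σ a b) := by
  have h1 : IsSemialgebraic ℚ {z : Fin (n + 1) → ℝ | (a : ℝ) ≤ z (Fin.last n)} := by
    simpa using Literature.ModelTheory.ExponentialFields.isSemialgebraic_setOf_eval_le (k := ℚ) (R := ℝ)
      (a : MvPolynomial (Fin (n + 1)) ℚ) (X (Fin.last n))
  have h2 : IsSemialgebraic ℚ {z : Fin (n + 1) → ℝ | z (Fin.last n) ≤ b} := by
    simpa using Literature.ModelTheory.ExponentialFields.isSemialgebraic_setOf_eval_le (k := ℚ) (R := ℝ)
      (X (Fin.last n)) (b : MvPolynomial (Fin (n + 1)) ℚ)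
  convert (hσ.setOf_init_mem.inter h1).inter h2 using 1
  ext z
  simp only [bandSet, mem_setOf_eq, mem_inter_iff, and_assoc]

/-- Bands are measurable. [folklore] -/
theorem measurableSet_bandSet {σ : Set (Fin n → ℝ)} (hσ : MeasurableSet σ) (a b : ℝ) :
    MeasurableSet (bandSet σ a b) := by
  have hinit : Measurable (Fin.init : (Fin (n + 1) → ℝ) → Fin n → ℝ) :=
    measurable_pi_lambda _ fun i => measurable_pi_apply _
  have hl : Measurable fun z : Fin (n + 1) → ℝ => z (Fin.last n) := measurable_pi_apply _
  refine (hσ.preimage hinit).inter ((measurableSet_le measurable_const hl).inter (measurableSet_le hl measurable_const))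

/-- The slab at level `0` is the band `[0,1]`. [folklore] -/
theorem slabDomain_zero (r : IntegralRep n) : r.slabDomain 0 = bandSet r.domain 0 1 := by
  ext z
  simp [IntegralRep.slabDomain, bandSet]

/-- The slab at level `1` is the band `[1,2]`. [folklore] -/
theorem slabDomain_one (r : IntegralRep n) : r.slabDomain 1 = bandSet r.domain 1 2 := by
  ext z
  simp only [IntegralRep.slabDomain, bandSet, mem_setOf_eq, Nat.cast_one]
  norm_num

/-! ### Bending the last coordinate -/

/-- The map `(x, s) ↦ (x, ψ s)`. -/
def bend (ψ : ℝ → ℝ) (z : Fin (n + 1) → ℝ) : Fin (n + 1) → ℝ :=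
  fun i => if i = Fin.last n then ψ (z (Fin.last n)) else z i

/-- `init (bend ψ z) = init z`. [folklore] -/
theorem init_bend (ψ : ℝ → ℝ) (z : Fin (n + 1) → ℝ) : Fin.init (bend ψ z) = Fin.init z := by
  funext i
  simp [Fin.init, bend, (Fin.castSucc_lt_last i).ne]

/-- `bend ψ z last = ψ (z last)`. [folklore] -/
theorem bend_last (ψ : ℝ → ℝ) (z : Fin (n + 1) → ℝ) : bend ψ z (Fin.last n) = ψ (z (Fin.last n)) := by
  simp [bend]

/-- The derivative of `bend ψ`: identity on the first `n` coordinates, `d` on the last. -/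
def bendDeriv (n : ℕ) (d : ℝ) : (Fin (n + 1) → ℝ) →L[ℝ] (Fin (n + 1) → ℝ) :=
  ContinuousLinearMap.pi fun i =>
    ((if i = Fin.last n then d else (1 : ℝ)) • ContinuousLinearMap.id ℝ ℝ).comp (ContinuousLinearMap.proj i)

/-- `det (bendDeriv d) = d`. [folklore] -/
theorem det_bendDeriv (d : ℝ) : (bendDeriv n d).det = d := by
  rw [bendDeriv, ContinuousLinearMap.det_pi]
  have h : ∀ i : Fin (n + 1), ((if i = Fin.last n then d else (1 : ℝ)) • ContinuousLinearMap.id ℝ ℝ).det =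
      (if i = Fin.last n then d else (1 : ℝ)) := by
    intro i
    rw [ContinuousLinearMap.det, ContinuousLinearMap.toLinearMap_smul, ContinuousLinearMap.coe_id,
      LinearMap.det_smul, LinearMap.det_id, Module.finrank_self]
    simp
  simp_rw [h]
  rw [Finset.prod_ite_eq']
  simp

/-- `bend ψ` has derivative `bendDeriv (ψ' s)` at `z` (`s = z last`). [folklore] -/
theorem hasFDerivAt_bend {ψ : ℝ → ℝ} {d : ℝ} {z : Fin (n + 1) → ℝ}
    (hψ : HasDerivAt ψ d (z (Fin.last n))) : HasFDerivAt (bend ψ) (bendDeriv n d) z := by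
  rw [show bend ψ = fun (z : Fin (n + 1) → ℝ) (i : Fin (n + 1)) =>
      (fun i z => if i = Fin.last n then ψ (z (Fin.last n)) else z i) i z from rfl]
  rw [bendDeriv, hasFDerivAt_pi]
  intro i
  by_cases hi : i = Fin.last n
  · subst hi
    simp only [if_true]
    have h := hψ.comp_hasFDerivAt z (hasFDerivAt_apply (𝕜 := ℝ) (Fin.last n) z)
    refine h.congr_fderiv ?_
    ext v
    simp
  · simp only [hi, if_false]
    refine (hasFDerivAt_apply (𝕜 := ℝ) i z).congr_fderiv ?_
    ext v
    simp

/-- A bend is a change-of-variables move, given the side conditions. [cite: KontsevichZagier2001, §1.2 rule (2)] -/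
theorem bend_mem_changeOfVariablesRel (A S : IntegralRep (n + 1)) (ψ ψ' : ℝ → ℝ)
    (hΦ : IsSemialgebraicMapOn ℚ A.domain (bend ψ))
    (hderiv : ∀ z ∈ A.domain, HasDerivAt ψ (ψ' (z (Fin.last n))) (z (Fin.last n)))
    (hinj : InjOn (bend ψ) A.domain) (himage : S.domain = bend ψ '' A.domain)
    (hint : ∀ z ∈ A.domain, A.integrand z = S.integrand (bend ψ z) * |ψ' (z (Fin.last n))|) :
    of A - of S ∈ changeOfVariablesRel := by
  refine ⟨n + 1, A, S, bend ψ, fun z => bendDeriv n (ψ' (z (Fin.last n))), hΦ,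
    fun z hz => (hasFDerivAt_bend (hderiv z hz)).hasFDerivWithinAt, hinj, himage, fun z hz => ?_, rfl⟩
  rw [det_bendDeriv]
  exact hint z hz

/-- `ψ₁ s = 2s − s² = 1 − (1 − s)²` (increasing bend of `[0,1]` onto itself, `ψ₁' (1) = 0`). -/
def ψ₁ (s : ℝ) : ℝ := 2 * s - s ^ 2
/-- `ψ₂ s = 1 + (s − 1)²` (increasing bend of `[1,2]` onto itself, `ψ₂' (1) = 0`). -/
def ψ₂ (s : ℝ) : ℝ := 1 + (s - 1) ^ 2

/-- `ψ₁' s = 2 − 2s`. [folklore] -/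
theorem hasDerivAt_ψ₁ (s : ℝ) : HasDerivAt ψ₁ (2 - 2 * s) s := by
  have h1 : HasDerivAt (fun x : ℝ => 2 * x - x ^ 2) (2 * 1 - ((2 : ℕ) : ℝ) * s ^ (2 - 1) * 1) s :=
    ((hasDerivAt_id' s).const_mul 2).sub ((hasDerivAt_id' s).pow 2)
  have h2 : (fun x : ℝ => 2 * x - x ^ 2) = ψ₁ := funext fun x => rfl
  rw [h2] at h1
  exact h1.congr_deriv (by push_cast; ring)

/-- `ψ₂' s = 2 (s − 1)`. [folklore] -/
theorem hasDerivAt_ψ₂ (s : ℝ) : HasDerivAt ψ₂ (2 * (s - 1)) s := by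
  have h1 : HasDerivAt (fun x : ℝ => 1 + (x - 1) ^ 2) (((2 : ℕ) : ℝ) * (s - 1) ^ (2 - 1) * 1) s :=
    (((hasDerivAt_id' s).sub_const 1).pow 2).const_add 1
  have h2 : (fun x : ℝ => 1 + (x - 1) ^ 2) = ψ₂ := funext fun x => rfl
  rw [h2] at h1
  exact h1.congr_deriv (by push_cast; ring)

/-- `bend ψ₁` is a `ℚ`-semialgebraic (polynomial) map. [folklore] -/
theorem isSemialgebraicMapOn_bend_ψ₁ {s : Set (Fin (n + 1) → ℝ)} (hs : IsSemialgebraic ℚ s) :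
    IsSemialgebraicMapOn ℚ s (bend ψ₁) := by
  refine (isSemialgebraicMapOn_aeval hs (fun i => if i = Fin.last n then
    (2 * X (Fin.last n) - X (Fin.last n) ^ 2 : MvPolynomial (Fin (n + 1)) ℚ) else X i)).congr ?_
  intro z _
  funext i
  by_cases hi : i = Fin.last n <;> simp [bend, hi, ψ₁]

/-- `bend ψ₂` is a `ℚ`-semialgebraic (polynomial) map. [folklore] -/
theorem isSemialgebraicMapOn_bend_ψ₂ {s : Set (Fin (n + 1) → ℝ)} (hs : IsSemialgebraic ℚ s) :
    IsSemialgebraicMapOn ℚ s (bend ψ₂) := by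
  refine (isSemialgebraicMapOn_aeval hs (fun i => if i = Fin.last n then
    (1 + (X (Fin.last n) - 1) ^ 2 : MvPolynomial (Fin (n + 1)) ℚ) else X i)).congr ?_
  intro z _
  funext i
  by_cases hi : i = Fin.last n <;> simp [bend, hi, ψ₂]

/-- Two tuples agree iff their `init`s and last coordinates agree. [folklore] -/
theorem eq_of_init_eq_of_last_eq {z w : Fin (n + 1) → ℝ} (h1 : Fin.init z = Fin.init w)
    (h2 : z (Fin.last n) = w (Fin.last n)) : z = w := by
  rw [← Fin.snoc_init_self z, ← Fin.snoc_init_self w, h1, h2]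

/-- `bend ψ₁` is injective on the band `[0,1]`. [folklore] -/
theorem injOn_bend_ψ₁ (σ : Set (Fin n → ℝ)) : InjOn (bend ψ₁) (bandSet σ 0 1) := by
  intro z hz w hw h
  have hl : ψ₁ (z (Fin.last n)) = ψ₁ (w (Fin.last n)) := by
    have := congrFun h (Fin.last n)
    simpa [bend] using this
  have hi : Fin.init z = Fin.init w := by
    have := congrArg Fin.init h
    rwa [init_bend, init_bend] at this
  refine eq_of_init_eq_of_last_eq hi ?_
  have hz1 := hz.2.2
  have hw1 := hw.2.2
  have hsq : (1 - z (Fin.last n)) ^ 2 = (1 - w (Fin.last n)) ^ 2 := by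
    simp only [ψ₁] at hl
    nlinarith [hl]
  have := (pow_left_inj₀ (by linarith) (by linarith) two_ne_zero).mp hsq
  linarith

/-- `bend ψ₂` is injective on the band `[1,2]`. [folklore] -/
theorem injOn_bend_ψ₂ (σ : Set (Fin n → ℝ)) : InjOn (bend ψ₂) (bandSet σ 1 2) := by
  intro z hz w hw h
  have hl : ψ₂ (z (Fin.last n)) = ψ₂ (w (Fin.last n)) := by
    have := congrFun h (Fin.last n)
    simpa [bend] using this
  have hi : Fin.init z = Fin.init w := by
    have := congrArg Fin.init h
    rwa [init_bend, init_bend] at this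
  refine eq_of_init_eq_of_last_eq hi ?_
  have hz1 := hz.2.1
  have hw1 := hw.2.1
  have hsq : (z (Fin.last n) - 1) ^ 2 = (w (Fin.last n) - 1) ^ 2 := by
    simp only [ψ₂] at hl
    linarith
  have := (pow_left_inj₀ (by linarith) (by linarith) two_ne_zero).mp hsq
  linarith

/-- `bend ψ₁` maps the band `[0,1]` onto itself. [folklore] -/
theorem image_bend_ψ₁ (σ : Set (Fin n → ℝ)) : bend ψ₁ '' bandSet σ 0 1 = bandSet σ 0 1 := by
  ext w
  simp only [mem_image]
  constructor
  · rintro ⟨z, hz, rfl⟩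
    refine ⟨by rw [init_bend]; exact hz.1, ?_, ?_⟩
    · rw [bend_last, ψ₁]; nlinarith [hz.2.1, hz.2.2]
    · rw [bend_last, ψ₁]; nlinarith [hz.2.1, hz.2.2]
  · intro hw
    set t := w (Fin.last n) with ht
    have ht0 : 0 ≤ t := hw.2.1
    have ht1 : t ≤ 1 := hw.2.2
    set u := Real.sqrt (1 - t) with hu
    have hu0 : 0 ≤ u := Real.sqrt_nonneg _
    have hu1 : u ≤ 1 := by
      rw [hu, Real.sqrt_le_one]; linarith
    have husq : u ^ 2 = 1 - t := Real.sq_sqrt (by linarith)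
    refine ⟨bend (fun _ => 1 - u) w, ⟨by rw [init_bend]; exact hw.1, ?_, ?_⟩, ?_⟩
    · rw [bend_last]; linarith
    · rw [bend_last]; linarith
    · refine eq_of_init_eq_of_last_eq (by rw [init_bend, init_bend]) ?_
      rw [bend_last, bend_last, ψ₁]
      nlinarith [husq]

/-- `bend ψ₂` maps the band `[1,2]` onto itself. [folklore] -/
theorem image_bend_ψ₂ (σ : Set (Fin n → ℝ)) : bend ψ₂ '' bandSet σ 1 2 = bandSet σ 1 2 := by
  ext w
  simp only [mem_image]
  constructor
  · rintro ⟨z, hz, rfl⟩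
    refine ⟨by rw [init_bend]; exact hz.1, ?_, ?_⟩
    · rw [bend_last, ψ₂]; nlinarith [hz.2.1, hz.2.2]
    · rw [bend_last, ψ₂]; nlinarith [hz.2.1, hz.2.2]
  · intro hw
    set t := w (Fin.last n) with ht
    have ht0 : 1 ≤ t := hw.2.1
    have ht1 : t ≤ 2 := hw.2.2
    set u := Real.sqrt (t - 1) with hu
    have hu0 : 0 ≤ u := Real.sqrt_nonneg _
    have hu1 : u ≤ 1 := by
      rw [hu, Real.sqrt_le_one]; linarith
    have husq : u ^ 2 = t - 1 := Real.sq_sqrt (by linarith)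
    refine ⟨bend (fun _ => 1 + u) w, ⟨by rw [init_bend]; exact hw.1, ?_, ?_⟩, ?_⟩
    · rw [bend_last]; linarith
    · rw [bend_last]; linarith
    · refine eq_of_init_eq_of_last_eq (by rw [init_bend, init_bend]) ?_
      rw [bend_last, bend_last, ψ₂]
      nlinarith [husq]

/-! ### The glued integrand and its primitive -/

/-- The glued integrand on `σ × [0,2]`: `2(1−s)·f x` below `s = 1`, `2(s−1)·g x` above. -/
def hglue (f g : (Fin n → ℝ) → ℝ) (z : Fin (n + 1) → ℝ) : ℝ :=
  if z (Fin.last n) ≤ 1 then 2 * (1 - z (Fin.last n)) * f (Fin.init z)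
  else 2 * (z (Fin.last n) - 1) * g (Fin.init z)

/-- Its fibrewise primitive: `(2s − s²)·f x` below `s = 1`, `f x + (s−1)²·g x` above. -/
def Hglue (f g : (Fin n → ℝ) → ℝ) (z : Fin (n + 1) → ℝ) : ℝ :=
  if z (Fin.last n) ≤ 1 then (2 * z (Fin.last n) - z (Fin.last n) ^ 2) * f (Fin.init z)
  else f (Fin.init z) + (z (Fin.last n) - 1) ^ 2 * g (Fin.init z)

section Semialg

variable {σ : Set (Fin n → ℝ)} {f g : (Fin n → ℝ) → ℝ}

/-- A polynomial in the last coordinate times `f ∘ init` is semialgebraic on a band. [folklore] -/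
theorem isSemialgebraicFunOn_poly_mul_comp_init (hσ : IsSemialgebraic ℚ σ) (hf : IsSemialgebraicFunOn ℚ σ f)
    (p : MvPolynomial (Fin (n + 1)) ℚ) (a b : ℕ) :
    IsSemialgebraicFunOn ℚ (bandSet σ a b) (fun z => aeval z p * f (Fin.init z)) := by
  have hB := isSemialgebraic_bandSet hσ a b
  have h1 : IsSemialgebraicFunOn ℚ (bandSet σ a b) (fun z => aeval z p) := isSemialgebraicFunOn_aeval hB p
  have h2 : IsSemialgebraicFunOn ℚ (bandSet σ a b) (fun z => f (Fin.init z)) :=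
    hf.comp_init.mono (fun _ hz => hz.1) hB
  exact IsSemialgebraicFunOn.mul_holds h1 h2

/-- `hglue` is semialgebraic on the band `[0,2]`. [folklore] -/
theorem isSemialgebraicFunOn_hglue (hσ : IsSemialgebraic ℚ σ) (hf : IsSemialgebraicFunOn ℚ σ f)
    (hg : IsSemialgebraicFunOn ℚ σ g) : IsSemialgebraicFunOn ℚ (bandSet σ 0 2) (hglue f g) := by
  have hp1 := isSemialgebraicFunOn_poly_mul_comp_init hσ hf (2 * (1 - X (Fin.last n))) 0 1
  have hp2 := isSemialgebraicFunOn_poly_mul_comp_init hσ hg (2 * (X (Fin.last n) - 1)) 1 2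
  have hunion : bandSet σ (0 : ℝ) 2 = bandSet σ 0 1 ∪ bandSet σ 1 2 := by
    ext z
    simp only [bandSet, mem_setOf_eq, mem_union]
    constructor
    · intro h
      rcases le_total (z (Fin.last n)) 1 with h1 | h1
      · exact Or.inl ⟨h.1, h.2.1, h1⟩
      · exact Or.inr ⟨h.1, h1, h.2.2⟩
    · rintro (h | h)
      · exact ⟨h.1, h.2.1, by linarith [h.2.2]⟩
      · exact ⟨h.1, by linarith [h.2.1], h.2.2⟩
  norm_num at hp1 hp2
  rw [hunion]
  refine IsSemialgebraicFunOn.union hp1 hp2 ?_ ?_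
  · intro z hz
    have h1 : z (Fin.last n) ≤ 1 := by simpa using hz.2.2
    simp [hglue, h1]
  · intro z hz
    have h1 : 1 ≤ z (Fin.last n) := by simpa using hz.2.1
    by_cases h : z (Fin.last n) ≤ 1
    · have : z (Fin.last n) = 1 := le_antisymm h h1
      simp [hglue, this]
    · simp [hglue, h]

/-- `Hglue` is semialgebraic on the band `[0,2]`. [folklore] -/
theorem isSemialgebraicFunOn_Hglue (hσ : IsSemialgebraic ℚ σ) (hf : IsSemialgebraicFunOn ℚ σ f)
    (hg : IsSemialgebraicFunOn ℚ σ g) : IsSemialgebraicFunOn ℚ (bandSet σ 0 2) (Hglue f g) := by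
  have hp1 := isSemialgebraicFunOn_poly_mul_comp_init hσ hf (2 * X (Fin.last n) - X (Fin.last n) ^ 2) 0 1
  have hp2a := isSemialgebraicFunOn_poly_mul_comp_init hσ hf 1 1 2
  have hp2b := isSemialgebraicFunOn_poly_mul_comp_init hσ hg ((X (Fin.last n) - 1) ^ 2) 1 2
  have hp2 : IsSemialgebraicFunOn ℚ (bandSet σ (1 : ℕ) 2)
      (fun z => f (Fin.init z) + (z (Fin.last n) - 1) ^ 2 * g (Fin.init z)) := by
    refine (IsSemialgebraicFunOn.add_holds hp2a hp2b).congr fun z _ => ?_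
    simp
  have hunion : bandSet σ (0 : ℝ) 2 = bandSet σ 0 1 ∪ bandSet σ 1 2 := by
    ext z
    simp only [bandSet, mem_setOf_eq, mem_union]
    constructor
    · intro h
      rcases le_total (z (Fin.last n)) 1 with h1 | h1
      · exact Or.inl ⟨h.1, h.2.1, h1⟩
      · exact Or.inr ⟨h.1, h1, h.2.2⟩
    · rintro (h | h)
      · exact ⟨h.1, h.2.1, by linarith [h.2.2]⟩
      · exact ⟨h.1, by linarith [h.2.1], h.2.2⟩
  norm_num at hp1 hp2
  rw [hunion]
  refine IsSemialgebraicFunOn.union hp1 hp2 ?_ ?_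
  · intro z hz
    have h1 : z (Fin.last n) ≤ 1 := by simpa using hz.2.2
    simp [Hglue, h1]
  · intro z hz
    have h1 : 1 ≤ z (Fin.last n) := by simpa using hz.2.1
    by_cases h : z (Fin.last n) ≤ 1
    · have : z (Fin.last n) = 1 := le_antisymm h h1
      simp [Hglue, this]
      norm_num
    · simp [Hglue, h]

end Semialg

/-! ### Integrability of the glued integrand -/

/-- A bounded measurable weight times `f ∘ init` is integrable on a slab. [folklore] -/
theorem integrableOn_weight_mul (r : IntegralRep n) (j : ℕ) (w : ℝ → ℝ) (hw : Continuous w)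
    (C : ℝ) (hC : ∀ s ∈ Icc (j : ℝ) (j + 1), |w s| ≤ C) :
    IntegrableOn (fun z : Fin (n + 1) → ℝ => w (z (Fin.last n)) * r.integrand (Fin.init z)) (r.slabDomain j) := by
  have hint : IntegrableOn (fun z : Fin (n + 1) → ℝ => r.integrand (Fin.init z)) (r.slabDomain j) :=
    r.integrableOn_slabDomain j
  have hmeas : AEStronglyMeasurable (fun z : Fin (n + 1) → ℝ => w (z (Fin.last n)))
      (volume.restrict (r.slabDomain j)) :=
    (hw.comp (continuous_apply _)).aestronglyMeasurable
  have hm : MeasurableSet (r.slabDomain j) := IntegralRep.measurableSet_domain_holds (r.slab j)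
  refine Integrable.bdd_mul (c := C) hint hmeas ?_
  rw [ae_restrict_iff' hm]
  refine Filter.Eventually.of_forall fun z hz => ?_
  have hz' : z (Fin.last n) ∈ Icc (j : ℝ) (j + 1) := ⟨hz.2.1, hz.2.2⟩
  simpa [Real.norm_eq_abs] using hC _ hz'

/-- `hglue f g` is integrable on `σ × [0,2]` when `f`, `g` are integrable on `σ`. [folklore] -/
theorem integrableOn_hglue (r₁ r₂ : IntegralRep n) (h : r₂.domain = r₁.domain) :
    IntegrableOn (hglue r₁.integrand r₂.integrand) (bandSet r₁.domain 0 2) := by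
  have h1 : IntegrableOn (fun z : Fin (n + 1) → ℝ => (2 * (1 - z (Fin.last n))) * r₁.integrand (Fin.init z))
      (bandSet r₁.domain 0 1) := by
    rw [← slabDomain_zero]
    refine integrableOn_weight_mul r₁ 0 (fun s => 2 * (1 - s)) (by fun_prop) 2 ?_
    intro s hs
    simp only [Nat.cast_zero, zero_add] at hs
    rw [abs_le]; constructor <;> nlinarith [hs.1, hs.2]
  have h2 : IntegrableOn (fun z : Fin (n + 1) → ℝ => (2 * (z (Fin.last n) - 1)) * r₂.integrand (Fin.init z))
      (bandSet r₁.domain 1 2) := by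
    rw [← h, ← slabDomain_one]
    refine integrableOn_weight_mul r₂ 1 (fun s => 2 * (s - 1)) (by fun_prop) 2 ?_
    intro s hs
    simp only [Nat.cast_one] at hs
    rw [abs_le]; constructor <;> nlinarith [hs.1, hs.2]
  have hm₁ : MeasurableSet (bandSet r₁.domain (0 : ℝ) 1) :=
    measurableSet_bandSet (IntegralRep.measurableSet_domain_holds r₁) 0 1
  have hm₂ : MeasurableSet (bandSet r₁.domain (1 : ℝ) 2) :=
    measurableSet_bandSet (IntegralRep.measurableSet_domain_holds r₁) 1 2
  have h1' : IntegrableOn (hglue r₁.integrand r₂.integrand) (bandSet r₁.domain 0 1) := by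
    refine h1.congr_fun (fun z hz => ?_) hm₁
    have : z (Fin.last n) ≤ 1 := hz.2.2
    simp [hglue, this]
  have h2' : IntegrableOn (hglue r₁.integrand r₂.integrand) (bandSet r₁.domain 1 2) := by
    refine h2.congr_fun (fun z hz => ?_) hm₂
    have h1z : 1 ≤ z (Fin.last n) := hz.2.1
    by_cases hle : z (Fin.last n) ≤ 1
    · have : z (Fin.last n) = 1 := le_antisymm hle h1z
      simp [hglue, this]
    · simp [hglue, hle]
  have hunion : bandSet r₁.domain (0 : ℝ) 2 = bandSet r₁.domain 0 1 ∪ bandSet r₁.domain 1 2 := by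
    ext z
    simp only [bandSet, mem_setOf_eq, mem_union]
    constructor
    · intro h
      rcases le_total (z (Fin.last n)) 1 with h1 | h1
      · exact Or.inl ⟨h.1, h.2.1, h1⟩
      · exact Or.inr ⟨h.1, h1, h.2.2⟩
    · rintro (h | h)
      · exact ⟨h.1, h.2.1, by linarith [h.2.2]⟩
      · exact ⟨h.1, by linarith [h.2.1], h.2.2⟩
  rw [hunion]
  exact h1'.union h2'

/-! ### §7B The chain of six moves -/

/-! ### One-variable calculus of the glued primitive -/

/-- The glued fibre primitive `G(s) = (2s − s²)p` (`s ≤ 1`), `p + (s−1)² q` (`s > 1`) is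
differentiable everywhere with derivative the glued integrand (both one-sided derivatives vanish
at `s = 1`). [folklore] -/
theorem hasDerivAt_glue (p q t : ℝ) :
    HasDerivAt (fun s : ℝ => if s ≤ 1 then (2 * s - s ^ 2) * p else p + (s - 1) ^ 2 * q)
      (if t ≤ 1 then 2 * (1 - t) * p else 2 * (t - 1) * q) t := by
  have hφ₁ : ∀ u : ℝ, HasDerivAt (fun s : ℝ => (2 * s - s ^ 2) * p) ((2 - 2 * u) * p) u := fun u =>
    (hasDerivAt_ψ₁ u).mul_const p
  have hφ₂ : ∀ u : ℝ, HasDerivAt (fun s : ℝ => p + (s - 1) ^ 2 * q) ((2 * (u - 1)) * q) u := fun u =>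
    (((((hasDerivAt_id' u).sub_const 1).pow 2).mul_const q).const_add p).congr_deriv (by push_cast; ring)
  rcases lt_trichotomy t 1 with ht | rfl | ht
  · rw [if_pos ht.le]
    refine ((hφ₁ t).congr_of_eventuallyEq ?_).congr_deriv (by ring)
    filter_upwards [Iio_mem_nhds ht] with s hs
    rw [if_pos (le_of_lt hs)]
  · rw [if_pos le_rfl]
    have hl : HasDerivWithinAt (fun s : ℝ => if s ≤ 1 then (2 * s - s ^ 2) * p else p + (s - 1) ^ 2 * q)
        0 (Iic 1) 1 := by
      have h : HasDerivWithinAt (fun s : ℝ => (2 * s - s ^ 2) * p) 0 (Iic 1) 1 :=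
        ((hφ₁ 1).hasDerivWithinAt (s := Iic 1)).congr_deriv (by ring)
      exact h.congr (fun s hs => by rw [if_pos (show s ≤ 1 from hs)]) (by rw [if_pos le_rfl])
    have hr : HasDerivWithinAt (fun s : ℝ => if s ≤ 1 then (2 * s - s ^ 2) * p else p + (s - 1) ^ 2 * q)
        0 (Ici 1) 1 := by
      have h : HasDerivWithinAt (fun s : ℝ => p + (s - 1) ^ 2 * q) 0 (Ici 1) 1 :=
        ((hφ₂ 1).hasDerivWithinAt (s := Ici 1)).congr_deriv (by ring)
      refine h.congr (fun s hs => ?_) (by rw [if_pos le_rfl]; ring)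
      by_cases hs1 : s ≤ 1
      · have : s = 1 := le_antisymm hs1 hs
        rw [if_pos hs1, this]; ring
      · rw [if_neg hs1]
    have h := hl.union hr
    rw [Iic_union_Ici, hasDerivWithinAt_univ] at h
    exact h.congr_deriv (by ring)
  · rw [if_neg (not_le.mpr ht)]
    refine (hφ₂ t).congr_of_eventuallyEq ?_
    filter_upwards [Ioi_mem_nhds ht] with s hs
    rw [if_neg (not_le.mpr hs)]

/-- The glued fibre primitive is continuous. [folklore] -/
theorem continuous_glue (p q : ℝ) :
    Continuous (fun s : ℝ => if s ≤ 1 then (2 * s - s ^ 2) * p else p + (s - 1) ^ 2 * q) :=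
  Continuous.if_le (by fun_prop) (by fun_prop) continuous_id continuous_const fun s hs => by
    have hs' : s = 1 := hs
    rw [hs']; ring

/-! ### The chain of moves -/

section Chain

variable (r r₁ r₂ : IntegralRep n)

/-- `A = [σ × [0,2], hglue f g]`. -/
def glueRep (h : r₂.domain = r₁.domain) : IntegralRep (n + 1) where
  domain := bandSet r₁.domain 0 2
  integrand := hglue r₁.integrand r₂.integrand
  isSemialgebraic_domain := by simpa using isSemialgebraic_bandSet r₁.isSemialgebraic_domain 0 2
  isSemialgebraicFunOn_integrand := isSemialgebraicFunOn_hglue r₁.isSemialgebraic_domain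
    r₁.isSemialgebraicFunOn_integrand (by rw [← h]; exact r₂.isSemialgebraicFunOn_integrand)
  integrableOn := integrableOn_hglue r₁ r₂ h

variable {r₁ r₂}

/-- `bandSet σ 0 1 ⊆ bandSet σ 0 2`. [folklore] -/
theorem band01_subset (σ : Set (Fin n → ℝ)) : bandSet σ (0 : ℝ) 1 ⊆ bandSet σ 0 2 :=
  fun _ hz => ⟨hz.1, hz.2.1, by linarith [hz.2.2]⟩

/-- `bandSet σ 1 2 ⊆ bandSet σ 0 2`. [folklore] -/
theorem band12_subset (σ : Set (Fin n → ℝ)) : bandSet σ (1 : ℝ) 2 ⊆ bandSet σ 0 2 :=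
  fun _ hz => ⟨hz.1, by linarith [hz.2.1], hz.2.2⟩

/-- `A₁ = [σ × [0,1], hglue f g]`. -/
def glueRep₁ (h : r₂.domain = r₁.domain) : IntegralRep (n + 1) :=
  (glueRep r₁ r₂ h).restrict (bandSet r₁.domain 0 1)
    (by simpa using isSemialgebraic_bandSet r₁.isSemialgebraic_domain 0 1) (band01_subset _)

/-- `A₂ = [σ × [1,2], hglue f g]`. -/
def glueRep₂ (h : r₂.domain = r₁.domain) : IntegralRep (n + 1) :=
  (glueRep r₁ r₂ h).restrict (bandSet r₁.domain 1 2)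
    (by simpa using isSemialgebraic_bandSet r₁.isSemialgebraic_domain 1 2) (band12_subset _)

/-- **Move 1 (rule 1a)**: split `σ × [0,2]` at `s = 1` (overlap a null hyperplane slice). [cite: KontsevichZagier2001, §1.2 rule (1)] -/
theorem glueSplit_mem_domainAddRel (h : r₂.domain = r₁.domain) :
    of (glueRep r₁ r₂ h) - of (glueRep₁ h) - of (glueRep₂ h) ∈ domainAddRel := by
  refine ⟨n + 1, glueRep r₁ r₂ h, glueRep₁ h, glueRep₂ h, ?_, ?_, fun _ _ => rfl, fun _ _ => rfl, rfl⟩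
  · show bandSet r₁.domain (0 : ℝ) 2 = bandSet r₁.domain 0 1 ∪ bandSet r₁.domain 1 2
    ext z
    simp only [bandSet, mem_setOf_eq, mem_union]
    constructor
    · intro hz
      rcases le_total (z (Fin.last n)) 1 with h1 | h1
      · exact Or.inl ⟨hz.1, hz.2.1, h1⟩
      · exact Or.inr ⟨hz.1, h1, hz.2.2⟩
    · rintro (hz | hz)
      · exact ⟨hz.1, hz.2.1, by linarith [hz.2.2]⟩
      · exact ⟨hz.1, by linarith [hz.2.1], hz.2.2⟩
  · have hsub : ((glueRep₁ h).domain ∩ (glueRep₂ h).domain : Set (Fin (n + 1) → ℝ)) ⊆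
        {z : Fin (n + 1) → ℝ | z (Fin.last n) = 1} := by
      rintro z ⟨hz1, hz2⟩
      exact le_antisymm hz1.2.2 hz2.2.1
    refine measure_mono_null hsub ?_
    rw [MeasureTheory.volume_pi]
    exact Measure.pi_hyperplane (μ := fun _ : Fin (n + 1) => (volume : Measure ℝ)) (Fin.last n) (1 : ℝ)

/-- **Move 2 (rule 2)**: bend `σ × [0,1]` by `s ↦ 2s − s²`, from the slab of `r₁`. [cite: KontsevichZagier2001, §1.2 rule (2)] -/
theorem bend₁_mem_changeOfVariablesRel (h : r₂.domain = r₁.domain) :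
    of (glueRep₁ h) - of (r₁.slab 0) ∈ changeOfVariablesRel := by
  refine bend_mem_changeOfVariablesRel (glueRep₁ h) (r₁.slab 0) ψ₁ (fun s => 2 - 2 * s)
    (isSemialgebraicMapOn_bend_ψ₁ (glueRep₁ h).isSemialgebraic_domain) (fun z _ => hasDerivAt_ψ₁ _)
    (injOn_bend_ψ₁ r₁.domain) ?_ ?_
  · show r₁.slabDomain 0 = bend ψ₁ '' bandSet r₁.domain 0 1
    rw [slabDomain_zero, image_bend_ψ₁]
  · intro z hz
    have hs1 : z (Fin.last n) ≤ 1 := hz.2.2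
    show hglue r₁.integrand r₂.integrand z = r₁.integrand (Fin.init (bend ψ₁ z)) * |2 - 2 * z (Fin.last n)|
    rw [init_bend, abs_of_nonneg (by linarith), hglue, if_pos hs1]
    ring

/-- **Move 3 (rule 2)**: bend `σ × [1,2]` by `s ↦ 1 + (s−1)²`, from the slab of `r₂`. [cite: KontsevichZagier2001, §1.2 rule (2)] -/
theorem bend₂_mem_changeOfVariablesRel (h : r₂.domain = r₁.domain) :
    of (glueRep₂ h) - of (r₂.slab 1) ∈ changeOfVariablesRel := by
  refine bend_mem_changeOfVariablesRel (glueRep₂ h) (r₂.slab 1) ψ₂ (fun s => 2 * (s - 1))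
    (isSemialgebraicMapOn_bend_ψ₂ (glueRep₂ h).isSemialgebraic_domain) (fun z _ => hasDerivAt_ψ₂ _)
    (injOn_bend_ψ₂ r₁.domain) ?_ ?_
  · show r₂.slabDomain 1 = bend ψ₂ '' bandSet r₁.domain 1 2
    rw [slabDomain_one, image_bend_ψ₂, h]
  · intro z hz
    have hs1 : 1 ≤ z (Fin.last n) := hz.2.1
    show hglue r₁.integrand r₂.integrand z = r₂.integrand (Fin.init (bend ψ₂ z)) * |2 * (z (Fin.last n) - 1)|
    rw [init_bend, abs_of_nonneg (by linarith), hglue]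
    by_cases hle : z (Fin.last n) ≤ 1
    · have : z (Fin.last n) = 1 := le_antisymm hle hs1
      rw [if_pos hle, this]
      ring
    · rw [if_neg hle]
      ring

variable {r}

/-- **Move 4 (rule 3)**: Newton–Leibniz on `σ × [0,2]` with the glued primitive `Hglue` lands on
`r = [σ, f + g]`. [cite: KontsevichZagier2001, §1.2 rule (3)] -/
theorem glue_mem_newtonLeibnizRel (h₁ : r₁.domain = r.domain) (h : r₂.domain = r₁.domain)
    (hadd : EqOn r.integrand (r₁.integrand + r₂.integrand) r.domain) :
    of (glueRep r₁ r₂ h) - of r ∈ newtonLeibnizRel := by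
  refine ⟨n, glueRep r₁ r₂ h, r, fun _ => (0 : ℝ), fun _ => (2 : ℝ), Hglue r₁.integrand r₂.integrand,
    ?_, ?_, ?_, fun _ _ => by norm_num, ?_, ?_, ?_, ?_, rfl⟩
  · exact isSemialgebraicFunOn_Hglue r₁.isSemialgebraic_domain r₁.isSemialgebraicFunOn_integrand
      (by rw [← h]; exact r₂.isSemialgebraicFunOn_integrand)
  · exact (isSemialgebraicFunOn_natCast r.isSemialgebraic_domain 0).congr fun _ _ => by simp
  · exact (isSemialgebraicFunOn_natCast r.isSemialgebraic_domain 2).congr fun _ _ => by simp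
  · show bandSet r₁.domain (0 : ℝ) 2 = _
    rw [h₁]
    rfl
  · intro x _
    have hfun : (fun t : ℝ => Hglue r₁.integrand r₂.integrand (Fin.snoc x t)) =
        fun t => if t ≤ 1 then (2 * t - t ^ 2) * r₁.integrand x else r₁.integrand x + (t - 1) ^ 2 * r₂.integrand x := by
      funext t
      simp [Hglue]
    rw [hfun]
    exact (continuous_glue _ _).continuousOn
  · intro x _ t _
    have hfun : (fun s : ℝ => Hglue r₁.integrand r₂.integrand (Fin.snoc x s)) =
        fun s => if s ≤ 1 then (2 * s - s ^ 2) * r₁.integrand x else r₁.integrand x + (s - 1) ^ 2 * r₂.integrand x := by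
      funext s
      simp [Hglue]
    have hval : (glueRep r₁ r₂ h).integrand (Fin.snoc x t) =
        (if t ≤ 1 then 2 * (1 - t) * r₁.integrand x else 2 * (t - 1) * r₂.integrand x) := by
      show hglue r₁.integrand r₂.integrand (Fin.snoc x t) = _
      simp [hglue]
    rw [hfun, hval]
    exact hasDerivAt_glue _ _ _
  · intro x hx
    rw [hadd hx]
    simp [Hglue]
    norm_num

/-- **RULE (1b) IS DERIVABLE FROM RULES (1a), (2), (3).** Every integrand-additivity generator
`[σ, f+g] − [σ, f] − [σ, g]` is a signed sum of six moves: two slabs (rule 3), two bends of the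
last coordinate (rule 2: `s ↦ 2s − s²` on `σ×[0,1]`, `s ↦ 1 + (s−1)²` on `σ×[1,2]`, making the
glued integrand `2(1−s)f`, `2(s−1)g` vanish at the junction), one split at `s = 1` (rule 1a), and
one Newton–Leibniz move on `σ × [0,2]` with the `C¹` glued primitive `(2s−s²)f`, `f + (s−1)²g`.
[cite: KontsevichZagier2001, §1.2] -/
theorem integrandAddRel_subset_closure :
    integrandAddRel ⊆ (AddSubgroup.closure (domainAddRel ∪ changeOfVariablesRel ∪ newtonLeibnizRel) :
      Set FormalRep) := by
  rintro c ⟨n, r, r₁, r₂, h₁, h₂, hadd, rfl⟩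
  have h : r₂.domain = r₁.domain := h₂.trans h₁.symm
  set H := AddSubgroup.closure (domainAddRel ∪ changeOfVariablesRel ∪ newtonLeibnizRel) with hH
  have hA : ∀ {d}, d ∈ domainAddRel → d ∈ H := fun hd => AddSubgroup.subset_closure (Or.inl (Or.inl hd))
  have hC : ∀ {d}, d ∈ changeOfVariablesRel → d ∈ H := fun hd => AddSubgroup.subset_closure (Or.inl (Or.inr hd))
  have hN : ∀ {d}, d ∈ newtonLeibnizRel → d ∈ H := fun hd => AddSubgroup.subset_closure (Or.inr hd)
  have m1 := hA (glueSplit_mem_domainAddRel h)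
  have m2 := hC (bend₁_mem_changeOfVariablesRel h)
  have m3 := hC (bend₂_mem_changeOfVariablesRel h)
  have m4 := hN (glue_mem_newtonLeibnizRel h₁ h hadd)
  have m5 := hN (r₁.of_slab_sub_of_mem_newtonLeibnizRel 0)
  have m6 := hN (r₂.of_slab_sub_of_mem_newtonLeibnizRel 1)
  have key : of r - of r₁ - of r₂ =
      -(of (glueRep r₁ r₂ h) - of r) + (of (glueRep r₁ r₂ h) - of (glueRep₁ h) - of (glueRep₂ h)) +
        (of (glueRep₁ h) - of (r₁.slab 0)) + (of (r₁.slab 0) - of r₁) +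
        (of (glueRep₂ h) - of (r₂.slab 1)) + (of (r₂.slab 1) - of r₂) := by
    abel
  show of r - of r₁ - of r₂ ∈ H
  rw [key]
  exact H.add_mem (H.add_mem (H.add_mem (H.add_mem (H.add_mem (H.neg_mem m4) m1) m2) m5) m3) m6

end Chain

/-- **The three rules (1a), (2), (3) already generate all relations**: `relations = closure
(domainAddRel ∪ changeOfVariablesRel ∪ newtonLeibnizRel)`. [cite: KontsevichZagier2001, §1.2] -/
theorem relations_eq_closure_three :
    relations = AddSubgroup.closure (domainAddRel ∪ changeOfVariablesRel ∪ newtonLeibnizRel) := by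
  refine le_antisymm ?_ ?_
  · unfold relations
    refine (AddSubgroup.closure_le _).mpr ?_
    rintro c (((hc | hc) | hc) | hc)
    · exact AddSubgroup.subset_closure (Or.inl (Or.inl hc))
    · exact integrandAddRel_subset_closure hc
    · exact AddSubgroup.subset_closure (Or.inl (Or.inr hc))
    · exact AddSubgroup.subset_closure (Or.inr hc)
  · unfold relations
    refine AddSubgroup.closure_mono ?_
    rintro c ((hc | hc) | hc)
    · exact Or.inl (Or.inl (Or.inl hc))
    · exact Or.inl (Or.inr hc)
    · exact Or.inr hc

end RuleOneB

end Summit.KontsevichZagierPeriods.KontsevichZagierPeriods.Cruxes.CompleteModGammaSector.Disproof
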